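import Mathlib
import Summits.ValiantsHypothesis.ValiantsHypothesis.Theorems.NewtonUnitEquationsTwoProductsPlanarCellChargingBound
import Summits.ValiantsHypothesis.ValiantsHypothesis.Theorems.NewtonUnitEquationsTwoProductsFormalLogLinearisationPlanarCellTransfer
import Summits.ValiantsHypothesis.ValiantsHypothesis.Theorems.NewtonUnitEquationsTwoProductsFormalLogLinearisationStubLogLinearisation
import Summits.ValiantsHypothesis.ValiantsHypothesis.Theorems.NewtonUnitEquationsTwoProductsFormalLogLinearisationLiftedPencilCountBound
import Summits.ValiantsHypothesis.ValiantsHypothesis.Theorems.NewtonUnitEquationsTwoProductsPlanarCellBlockLaw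
import Summits.ValiantsHypothesis.ValiantsHypothesis.Theorems.NewtonUnitEquationsTwoProductsPlanarCellSingleRelation
import Summits.ValiantsHypothesis.ValiantsHypothesis.Theorems.NewtonUnitEquationsTwoProductsPlanarCellRelationClasses
import Summits.ValiantsHypothesis.ValiantsHypothesis.Theorems.NewtonUnitEquationsTwoProductsPermutationTypeFamily
import Summits.ValiantsHypothesis.ValiantsHypothesis.Theorems.NewtonUnitEquationsTwoProductsFormalLogLinearisationBinomialPencilCount
import Summits.ValiantsHypothesis.ValiantsHypothesis.Theorems.NewtonUnitEquationsTwoProductsFormalLogLinearisationShiftRankCell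
import Summits.ValiantsHypothesis.ValiantsHypothesis.Theorems.NewtonUnitEquationsTwoProductsRankOneFourLawCount
import HarnessLib
import Summits.ValiantsHypothesis.ValiantsHypothesis.Theorems.NewtonUnitEquationsTwoProductsRankOneThreeLawLaw
import Summits.ValiantsHypothesis.ValiantsHypothesis.Theorems.NewtonUnitEquationsTwoProductsRankOneAPLawCount
import Summits.ValiantsHypothesis.ValiantsHypothesis.Theorems.NewtonUnitEquationsTwoProductsRankOneThreeGenLawLaw
import Summits.ValiantsHypothesis.ValiantsHypothesis.Theorems.NewtonUnitEquationsTwoProductsRankOneSchemaLawLaw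
import Summits.ValiantsHypothesis.ValiantsHypothesis.Theorems.NewtonUnitEquationsTwoProductsConfinedTameLawBridge
import Summits.ValiantsHypothesis.ValiantsHypothesis.Theorems.NewtonUnitEquationsTwoProductsRaySplitLaw
import Summits.ValiantsHypothesis.ValiantsHypothesis.Theorems.NewtonUnitEquationsTwoProductsMomentRecordShiftedCarrierLaw
import Summits.ValiantsHypothesis.ValiantsHypothesis.Theorems.NewtonUnitEquationsTwoProductsSubmergedReduction
import Summits.ValiantsHypothesis.ValiantsHypothesis.Theorems.NewtonUnitEquationsTwoProductsTowerRecordRealizableCarrier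

/-!
# Line `relation_ladder` for crux `TwoProducts` (stmt-ValiantsHypothesis-5906) — val-idea-8 g2/g3 (lens decomp)

SKELETON (D-0145): typed stubs + kernel-checked composition to the crux BY NAME
**v25 (pen val-port-1 g4, 2026-08-29 ≈00:5xZ; crit-8 g2's FORMAL R13♯ FOLD ASK 00:27:33Z).** NEW RUNG R13♯ = `TowerRecord.LevelFreeCarrierLawE`
(val-idea-37 g4's tower record laws — tower count T1–T6, sparse levels, the parametric valuated-matroid WALK `levelFreeRecordLaw_holds` (GP exchange +
rank potential + envelope), transplanted / lifted / composed by val-lit-p3 g18, 18 files ✓: `…TowerRecord{Defs,Lemma,Cells,Count,Sparse,Levels,Walk,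
Cramer,Envelope,Sweep}`, `…TowerRecordLift{Model,ClassSum,Record,Realizable}`, `…TowerRecord{CarrierLaw,LevelFreeCarrier,RealizableCarrier}`; statements
crit-8 g2): every normalised `t`-sparse instance whose tail alphabet lies in `⊔_{j ∈ E} (X + j•d)` for ANY finite level set `E` (carriers
`x : Fin n → ℕ²`, ONE shift `d ∈ ℤ²`; `TowerRecord.Lift.TowerAlphabet u v x d E`), REALIZABLE-dissociated (`TowerRecord.TowerDissociatedE x d m E`:
`(S,k) ↦ S•x + k•d` injective on `|S| ≤ m`, `k ∈ sumset E |S|`), obeys the per-cell law with ABSOLUTE `(a, b) = (11, 1)` — NO height, NO level count,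
NO box (`TowerRecord.levelFreeCarrierLawE_holds`, ✓ p681573) — `stub_levelFreeCarrierE` closed BY NAME; R12 ⊊ R13 ⊊ R13-sparse ⊊ R13∞ ⊊ R13♯ by name
(`shiftedCarrier_of_towerCarrier_holds`, `towerCarrierLaw_of_levelFreeCarrierLaw`, `sparseLevelCarrierLaw_of_levelFreeCarrierLaw`,
`levelFreeCarrierLaw_of_realizable`).  `ResidualLawV25 := ∃ C a b, [V24 clauses at C] ∧ ¬(∃ n x d E, TowerAlphabet u v x d E ∧ TowerDissociatedE x d m E) →
every SUBMERGED cell family is small` (no guard needed: the law is uniform in `n`, `E`, `D`; the R12 hatch stays for readability — it is the case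
`E = {0,1}` via `towerDissociated_one_iff` + `towerDissociatedE_of_towerDissociated`); `residualLawV25_of_V24` PROVED (weaker, never stronger); cone
`submergedCellLaw_v25` (v24's split + «tower alphabet with realizable dissociation → R13♯») → `planarCellBound_v25` (K4 lift) → `TwoProducts_holds_of_stubs`
(v24's pair `submergedCellLaw_v24` / `planarCellBound_v24` = git ≤ v24 @0e8636e50ed1).  sorries 1 = `stub_residual : ResidualLawV25` (LAW).  CARRIERS NOTE
(crit-8): carriers may be taken to be the classes of tail letters mod `ℤd`; overlapping towers on a common line are ONE tower (re-carriering), so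
row-lumped families are on the COVERED side.  HONEST LABEL (crit-8, binding): R13…R13♯ are CLASS rungs — parallel towers along ONE direction on
realizable-dissociated carriers — INERT AS HATCHES (they shrink the named residual, they do not price it); the coefficient side of the TwoProducts record
engine is closed at law level; residual of record after v25 = the D-free COLLISION residual (`(S,k) ↦ S•x + k•d` non-injective: F10 digit towers,
fibre lumping) + ≥ 2 independent shift directions; ⟺ `PlanarCellBound` per fixed `C` by construction; 5906 / `PlanarCellBound` OPEN; VP ≠ VNP NOT moved.
**v24 (pen val-port-1 g4, 2026-08-28 ≈23:5xZ).** NEW RUNG R12 (B) = `MomentRecord.ShiftedCarrierLaw` (crit-8 g2's W3/W4 text ✓ `…MomentRecordDefs`;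
PROVED: (A∘) `momentRecordLawUsed_holds` — idea-37 g4 «record letters are free», transplanted by val-port-3 g3, ✓ `…MomentRecord{Letters,Cells,Count}` —
and the glue of record (A∘) ⇒ (B) `Lift.shiftedCarrier_of_lawUsed_holds`, val-lit-p3 g17's lumped free-ring transfer ✓ p677026 `…MomentRecordLiftRecord`):
instances whose tail alphabet lies in `X ⊔ (X + d)` (carriers `x : Fin n → ℕ²`, ONE shift `d ∈ ℤ²`), carrier-dissociated to depth `m`, obey the per-cell
law with ABSOLUTE `(a, b)` — `stub_shiftedCarrier` closed BY NAME.  K4 «WLOG SUBMERGED» (val-idea-36 `submerged-band-filtration`; PROVED by val-lit-p3 g17,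
✓ `…SubmergedReduction :: Submerged.submergedReduction_holds : ∀ a b, SubmergedCellLaw a b → CellLaw (a+1) (b+1)`) is threaded as the CONCLUSION
CURRENCY of the residual (desk #333 (c): pen's + neg-1's call after (A3) landed; TYPING RULE R289: WLOG-type hypothesis admissible with the proved
reduction cited by name; crit-8 g2 20:09:40Z «admissible, mildly useful»): `stub_submerged` closed BY NAME.  `ResidualLawV24 := ∃ C a b, [hypotheses of
V23 at this C] ∧ ¬(∃ n x d, tailSupport ⊆ X ⊔ (X+d) ∧ CarrierDissociated x d m) → every SUBMERGED cell family is small` (`n` free: (B)'s bound is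
uniform in `n`); `residualLawV24_of_V23` PROVED (weaker, never stronger).  Because K4 is a GLOBAL reduction (it truncates the instance, and the residual's
hypotheses are not truncation-stable), the cone is re-assembled in submerged currency: `submergedCellLaw_v24` (per SUBMERGED cell: datum → R9 · R5/R3♯ ·
R1_r · confined-tame → R10 · ray-split with `≤ C` rays → R11 · shifted-carrier → R12 · else the v24 residual) gives `∃ a b, SubmergedCellLaw a b`,
`planarCellBound_v24` lifts it by K4 to the `PlanarCellBound` shape at `(a+1, b+1)`, and the single crux-concluding decl `TwoProducts_holds_of_stubs` is
`twoProducts_of_planarCellBound (planarCellBound_v24 …)`.  sorries 1 = `stub_residual : ResidualLawV24` (LAW).  HONEST LABEL: R12 is a CLASS rung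
(first log-concise class with a shifted alphabet), inert as a hatch (forecast, T6/T8/T9 common-tower mechanism: a common deep tower in a fresh direction
leaves `X ⊔ (X+d)`); K4 is an EQUIVALENCE of regimes; so for every fixed `C` the v24 residual is again ⟺ `PlanarCellBound` as a law (label of record
for v23: ✓ p662518 `Negative/RaySplitResidual.residualV23_iff_planarCellBound`).  5906 / `PlanarCellBound` OPEN; VP ≠ VNP NOT moved.
**v23 (val-lit-p3 g16, 2026-08-28 ≈19:3xZ; pen val-port-1 g3).** NEW RUNG R11 (Stage 1) = `RaySplitCellLaw` (val-idea-32's `freiman-ray-split`,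
crit-8 KEEP, director R289): letters on `K` rays (`OnRays`) with NO CROSS-RAY coincidences (`RayCrossFree`) ⇒ every cell family has `#S ≤ 2^((m+1)·K)`
— t-FREE, ANY in-ray rank — PROVED: `stub_raySplit := R11.raySplitCellLaw_holds` (`Theorems/…RaySplit{Lift,Span,Law}`: Freiman ray-splitting lift as
`phiT M (liftG cU cV)`, injectivity of the planar projection on the lifted support, coefficient-span lemma `[Z_{−i}^c]P̃ ∈ 𝒜_i`, valuation box via
`Separated.exists_echelon_fintype`; `IndepRays` is NOT used).  `ResidualLawV23 := ∃ C a b, [hypotheses of V22 at this C] ∧ ¬(∃ K ≤ C, ∃ g ι ν,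
IndepRays g ∧ OnRays g ι ν (tailSupport u v) ∧ RayCrossFree ι A) → cells small` (K MUST be bounded by the chosen C — val-neg-1 g5's pre-audit l.8766: with K free
the hatch would swallow every generic instance while R11 only pays `2^((m+1)·2mt)`); `residualLawV23_of_V22` PROVED (weaker) and `residualLawV22_of_V23 :
ResidualLawV23 → RaySplit.RaySplitCellLaw → ResidualLawV22` PROVED (`2^((m+1)K) ≤ 2^(C·m)·(t+2)^C` for `K ≤ C`); composition = `planarCellBound_v21` fed
`residualLawV21_of_V22 (residualLawV22_of_V23 stub_residual stub_raySplit) stub_confinedTame`; single crux-concluding decl `TwoProducts_holds_of_stubs`.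
sorries 1 = `stub_residual : ResidualLawV23` (LAW).  HONEST LABEL (val-neg-1 g5 forecast, l.8766 (2)): for every fixed `C` the v23 residual is again
⟺ `PlanarCellBound` (C+1 common deep monomial factors force ≥ C+2 rays; cost m ↦ m+C+1).  5906 / `PlanarCellBound` OPEN; VP ≠ VNP NOT moved.
**v22 (val-lit-p3 g16, 2026-08-28 ≈19:1xZ; pen val-port-1 g3 per desk #318/#325).** NEW RUNG R10 = `ConfinedTameLaw C` (val-idea-37's
`positive-circuit-chart`, crit-8 VERDICT #2, director R275): letter-confined (`#L ≤ C·m`) and tame (fibre spread `≤ (m+2)^C`) relation lattices obey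
the per-cell law — ANY coincidence rank, NO datum — PROVED FOR ALL `C`: `stub_confinedTame := R10.confinedTameLaw_holds` (`Theorems/…ConfinedTameLaw
{Circuits,Chart,ChartMain,Lift,Fibres,Slice,SliceFibre,SliceMin,Count,Arith,Defs,Bridge}`, positive-circuit chart + mass-regrouped slice functions).
`ResidualLawV22 := ∃ C, [hypotheses of V21] ∧ ¬(∃ L, #L ≤ C·m ∧ R10Defs.LetterConfined A L ∧ R10Defs.FibreSpread A L ((m+2)^C)) → cells small`
(the prover of the residual may choose `C`); `residualLawV22_of_V21` PROVED (weaker, never stronger) and `residualLawV21_of_V22 : ResidualLawV22 →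
(∀ C, R10Defs.ConfinedTameLaw C) → ResidualLawV21` PROVED, so the composition is `planarCellBound_v21` fed `residualLawV21_of_V22 stub_residual
stub_confinedTame`; the single crux-concluding declaration stays `TwoProducts_holds_of_stubs`.  sorries 1 = `stub_residual : ResidualLawV22` (LAW).
HONEST LABEL (val-neg-1 g5, `Theorems/TwoProducts/Negative/TowerPaddingResidual.lean :: residualNotTame_iff_planarCellBound (C)`): for every
fixed `C` the v22 residual is EQUIVALENT to `PlanarCellBound` (binary-tower + full padding) — R10 is a genuine proper sub-law, but it excises no
asymptotic content from the LAW; after it the line still owes `PlanarCellBound` in full.  5906 / `PlanarCellBound` OPEN; VP ≠ VNP NOT moved.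
**v21 CANDIDATE (val-lit-p3 g16, 2026-08-28; for the line owner / a seat with crux-write on 5906).** (i) The inline copy of the R7b module is
replaced by `import …RankOneThreeGenLawLaw` (val-lit-p3 g15's port; `R7b.rankOneThreeGenLaw_proof`, `R7b.rankOneTwoLaw_proof`,
`R7b.visible_bound_free/hom`, `R6c.rankOneCoincidences_symm` BY NAME — statements unchanged, DefeqCheckR7 ✓).  (ii) NEW RUNG R9 = the RANK-ONE
SCHEMA law `RankOneSchemaLaw` (ONE datum `(ρ⁺, ρ⁻)` of ANY shape ⇒ the global visible bound), PROVED: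
`stub_rankOneSchema := PermutationType.R9.rankOneSchemaLaw_proof` (`Theorems/…RankOneSchemaLaw{Lift,…,Law}`, transportation lift); it SUBSUMES
R3♯/R6/R6b/R6c/R7a/R7b/R7c/R8.  (iii) `ResidualLawV21` := the R5/R1_r hypotheses of V20 ∧ `¬ HasDatum A` (coincidence module of RANK ≥ 2);
`residualLawV21_of_V20` PROVED (weaker); composition `planarCellBound_v21` + the single crux-concluding `TwoProducts_holds_of_stubs` = `R9 | R5 | R1_r | residual` (v21′: binder forms `TwoProducts_of_v20/v21` removed so the registry sees ONE candidate); sorries 1 =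
`stub_residual : ResidualLawV21` (LAW).  5906 / `PlanarCellBound` OPEN; VP ≠ VNP NOT moved.
**v20 (val-idea-8 g3, 2026-08-28 ≈12:3xZ) — CURRENT CONE.** `TwoProducts_holds_of_stubs := TwoProducts_of_v20 stub_permType stub_relationClasses
stub_rankOneFour stub_rankOneThreeGen stub_rankOneTwo stub_residual`; kernel theorems BY NAME: R3♯ (`permTypeLaw_proof`), R1_r (`relationClassesLaw`),
R6 (`PermutationType.rankOneFourLaw_proof`, port p624287), **R7b (`PermutationType.R7b.rankOneThreeGenLaw_proof`: rank one with relation `pα = qβ + rγ` on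
THREE distinct tail letters, ALL `p, q, r ≥ 1`) and R7c (`PermutationType.R7b.rankOneTwoLaw_proof`: rank one on TWO letters with torsion `pα = qβ`,
`α ≠ β`) from the inline copy of `Lines/relation_ladder_R7b.lean` REV 2 @0e509ffbbbd2 (0 sorries; lift `Y_α ↦ Y_β^q Y_γ^r, Y_β ↦ Y_β^p, Y_γ ↦ Y_γ^p`
over the `p`-DILATED plane `enumP`, fibres with divisibility guards, DOUBLE slicing, coefficient theorem, finite shift rank,
`ShiftRank.pencilCount` by name; R7c = the `r = 0` instance with an idle third tail letter, two-letter alphabets have `≤ 3^m` support points;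
a coefficient `> m` or an absent relation letter ⇒ permutation type)**.  The three-letter rungs R6b (`stub_rankOneThree`, by name
`PermutationType.R6b.rankOneThreeLaw_proof`), R6c (`stub_rankOneThreeAP`, by name p629757), R7a (`stub_rankOneThreeFree`, `p = 1`) and R6d
(`stub_rankOneHomThree`, val-lit-p3 g15's homogeneous shape) stay THEOREMS in this file; since v20 the composition reaches them through R7b's
witness embeddings (`threeTermGenRankOne_of_free ∘ threeTermFreeRankOne_of_threeTerm`, `threeTermGenRankOne_of_hom ∘ threeTermHomRankOne_of_AP`)
instead of separate cone inputs (their per-cell forms `cell_bound_of_rankOneThree/…AP/…Free/…HomThree` were removed, git ≤ v19 @bc7a63357f94).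
sorries 1 = `stub_residual : ResidualLawV20` (LAW, 0 provers) := V19 hypotheses ∧ `¬ TwoTermRankOne` (`residualLawV20_of_V19` PROVED: weaker).
COVERAGE after v20: every letter family whose additive coincidences are RANK ONE with primitive relation supported on ≤ 3 tail letters (any
coefficients; support 2 = torsion `pα = qβ`) or of four-term unit shape `α + β = γ + δ` (R6) is a kernel theorem.  RESIDUAL = «no lattice-small
block contraction to permutation type (R5), no cheap relation-class cover (R1_r), coincidences not rank one of those shapes» — i.e. rank one
on FOUR letters with general coefficients (`pα + p′α′ = qβ + rγ`, `pα = qβ + rγ + sδ`, …: two substituted letters, the transportation lift of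
memo `Lines/relation_ladder_R7_engine.md`), on ≥ 5 letters, and relation modules of rank ≥ 2.  5906 / `PlanarCellBound` OPEN; VP ≠ VNP NOT moved.

HISTORY (one line per version; full paragraphs in git ≤ v18 @e7ad6555a1a7 / ≤ v19 @bc7a63357f94; superseded compositions removed, rungs and
residual-monotonicity lemmas stay): v4 `BlockLaw`/`ConfinedLaw` PROVED, cone through `twoProducts_of_planarCellBound` (p596451) · v5 residual
SHARPENED · v6 R3 (`B_m` alphabets) · v7 R3 PROVED · v8 R2/R2⁺ by name (p607798, p608838), corollaries `planarCell_smallSumset`/`_of_le_four`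
(residual lives at `m ≥ 5`) · v9 R3♯ `PermTypeLaw` PROVED, in the cone · v10 R5 `MergedPermTypeLaw` PROVED · v11 R1 by name (p611681, val-lit-p3
g14) · v12 R1_r by name (p613574) folded into the cone; first residual instances `(m,t) = (10,32)`, `(6,209)` located · v13 toolkit = `import
…PermutationTypeFamily` (val-port-2) · v14 R6 four-term rank one PROVED SPLIT (p620797 ⇒ theorem; port p624287) · v15 R6b `α = β + γ` PROVED
(module `…R6b.lean`) · v16 R6c typed · v17 R6b by name (p3's port) · v18 R7a `α = qβ + rγ` PROVED inline, R6d typed, R6c by name (p629757) ·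
v19 R7b `pα = qβ + rγ` PROVED inline, R7a/R6d instances, sorries 1.
-/

noncomputable section

set_option linter.dupNamespace false

open scoped BigOperators
open MvPolynomial
open Summit.ValiantsHypothesis.ValiantsHypothesis.Theorems.NewtonUnitEquations.TwoProducts.FormalLogLinearisation
open Summit.ValiantsHypothesis.ValiantsHypothesis.Theorems.NewtonUnitEquations.TwoProducts.PlanarCell
open Summit.ValiantsHypothesis.ValiantsHypothesis.Theorems.NewtonUnitEquations.TwoProducts

namespace Summit.ValiantsHypothesis.ValiantsHypothesis.Cruxes.TwoProducts.RelationLadder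

/-! ## R3 TOOLKIT — IN THE TREE (v13 wiring): `…Theorems.NewtonUnitEquationsTwoProductsPermutationType{WeightOrder, Lifted, PushForward, Count,
Family}` (p611005, p611551, p612335, p613478, p614165; val-port-2, verbatim from this line's turnkey), namespace `…TwoProducts.PermutationType`;
the rungs below are wired to them BY NAME. -/


variable {m : ℕ}

-- `tuples`, `IsCellFamily`, `Confined`, `BlockSmall`, the block-merge toolkit, `planarCell_blockLaw`, `blockSmall_of_card` and
-- `planarCell_confined` are the LANDED ports p607798 `…PlanarCellBlockMerge` / p608838 `…PlanarCellBlockLaw` (val-port-2 g0, verbatim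
-- this line's v4 proofs); v8 wires the rungs to them by name.

/-- SINGLE RELATION CLASS: one primitive relation `(a₀, b₀)` on a position set `J` accounts for every coincidence —
two distinct letter tuples with the same point differ exactly on `J` and carry `(a₀, b₀)` or `(b₀, a₀)` there. -/
def SingleRelation (A : Fin m → Finset Expo) : Prop :=
  ∃ J : Finset (Fin m), ∃ a₀ b₀ : Fin m → Expo, ∀ a ∈ tuples A, ∀ b ∈ tuples A, a ≠ b → ∑ j, a j = ∑ j, b j →
    (∀ j, a j ≠ b j ↔ j ∈ J) ∧ ((∀ j ∈ J, a j = a₀ j ∧ b j = b₀ j) ∨ (∀ j ∈ J, a j = b₀ j ∧ b j = a₀ j))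

/-! ## Stubs -/

/-- RUNG R2 (confined-relation law; provable: block-merge of `J` + `planarCell_dissociated_linear` + refinement of the cell by the
weight order on the `≤ (s+1)^κ + m s` merged letters).  Statement kept in `PlanarCellBound` shape. -/
def ConfinedLaw : Prop :=
  ∃ a b : ℕ, ∀ (m s κ : ℕ) (u v : Fin m → MvPolynomial (Fin 2) ℂ) (A : Fin m → Finset Expo) (J : Finset (Fin m)),
    (∀ j, (0 : Expo) ∉ A j) → (∀ j, (A j).card ≤ s) → (∀ j, (u j).support ⊆ A j) → (∀ j, (v j).support ⊆ A j) →
    J.card ≤ κ → Confined A J →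
    ∀ (R : Expo → Expo → Prop) (S : Finset Expo), IsCellFamily u v R S →
      S.card ≤ 2 ^ (a * m) * (s + 2) ^ (b * (κ + 1))

/-- RUNG R2⁺ (block law; provable by the same block-merge: the merged instance is dissociated with `m − |J| + 1` factor pairs and
`≤ M + m s` letters, so `planarCell_dissociated_linear` and the refinement of the cell by the weight order on the merged letters
give `O(m (M + m s)²)`).  The bound depends on the SIZE `M` of the block sumset, not on `|J|`: it covers lattice-small blocks of
ANY number of positions (`M ≤ (|J|δ+1)²` for letters in a `δ`-box) as well as `|J| ≤ κ` (`M ≤ (s+1)^κ`, whence `ConfinedLaw`,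
proved below).  Not in the composition (R2 is); first prover target. -/
def BlockLaw : Prop :=
  ∃ a b : ℕ, ∀ (m s M : ℕ) (u v : Fin m → MvPolynomial (Fin 2) ℂ) (A : Fin m → Finset Expo) (J : Finset (Fin m)),
    (∀ j, (0 : Expo) ∉ A j) → (∀ j, (A j).card ≤ s) → (∀ j, (u j).support ⊆ A j) → (∀ j, (v j).support ⊆ A j) →
    Confined A J → BlockSmall A J M →
    ∀ (R : Expo → Expo → Prop) (S : Finset Expo), IsCellFamily u v R S →
      S.card ≤ 2 ^ (a * m) * (M + s + 2) ^ b

/-- **THE BLOCK LAW (R2⁺), PROVED**: confined coincidences + a block sumset of size `≤ M` ⇒ per cell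
`#S ≤ 2^{3m}·(M+s+2)^9`.  Merge the block into `j₀ ∈ J` (`merge`, same `m`); the merged letter family `mergeA` is dissociated
(`injOn_mergeA`, from `Confined`); strict tops transfer through `tailDiff` equality by `stub_logLinearisation` (tree) — no log
additivity is used; the cell is refined over the merged tails by `planarOrder_classes` (tree); each class is bounded by
`planarCell_dissociated_linear` (p603804). -/
theorem stub_blockLaw : BlockLaw :=
  ⟨3, 9, fun m s M u v A J hA0 hAs hu hv hconf hblk R S hS =>
    by simpa [Nat.mul_comm] using planarCell_blockLaw s M u v A J hA0 hAs hu hv hconf hblk R S hS⟩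

/-- `BlockLaw ⇒ ConfinedLaw` (with constants `(a, 2b)`): `M ≤ (s+1)^κ` and `(s+1)^κ + s + 2 ≤ 2 (s+2)^{κ+1}`,
`2^b ≤ (s+2)^b`, `κ + 2 ≤ 2(κ+1)`. -/
theorem confinedLaw_of_blockLaw (h : BlockLaw) : ConfinedLaw := by
  obtain ⟨a, b, h⟩ := h
  refine ⟨a, 2 * b, ?_⟩
  intro m s κ u v A J hA0 hAs hu hv hJ hconf R S hS
  have key := h m s ((s + 1) ^ J.card) u v A J hA0 hAs hu hv hconf (blockSmall_of_card A J s hAs) R S hS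
  refine key.trans (Nat.mul_le_mul_left _ ?_)
  -- ((s+1)^|J| + s + 2)^b ≤ (s+2)^(2b(κ+1))
  have h1 : (s + 1) ^ J.card ≤ (s + 2) ^ (κ + 1) :=
    (Nat.pow_le_pow_left (by omega) _).trans (Nat.pow_le_pow_right (by omega) (by omega))
  have hs : s + 2 ≤ (s + 2) ^ (κ + 1) := Nat.le_self_pow (by omega) _
  have hX : 2 ≤ (s + 2) ^ (κ + 1) := le_trans (by omega) hs
  have h2 : (s + 1) ^ J.card + s + 2 ≤ (s + 2) ^ (κ + 1) * (s + 2) ^ (κ + 1) := by nlinarith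
  have h3 : (s + 2) ^ (κ + 1) * (s + 2) ^ (κ + 1) = (s + 2) ^ (2 * (κ + 1)) := by rw [← pow_add]; ring_nf
  calc ((s + 1) ^ J.card + s + 2) ^ b ≤ ((s + 2) ^ (2 * (κ + 1))) ^ b :=
        Nat.pow_le_pow_left (h2.trans_eq h3) _
    _ = (s + 2) ^ (2 * b * (κ + 1)) := by rw [← pow_mul]; ring_nf

/-- RUNG R1 (single-relation law; provable: fibre sums are the pair sums `F + F∘ρ`, rank-one off `J_ρ`; dirty points have a
`≤ 2`-upgrade in the slice `{c | c|J ∈ {a₀|J, b₀|J}}`, pinned on `J ∖ U`).  Witness rung, not in the composition. -/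
def SingleRelationLaw : Prop :=
  ∃ c d : ℕ, ∀ (m s : ℕ) (u v : Fin m → MvPolynomial (Fin 2) ℂ) (A : Fin m → Finset Expo),
    (∀ j, (0 : Expo) ∉ A j) → (∀ j, (A j).card ≤ s) → (∀ j, (u j).support ⊆ A j) → (∀ j, (v j).support ⊆ A j) →
    SingleRelation A →
    ∀ (R : Expo → Expo → Prop) (S : Finset Expo), IsCellFamily u v R S →
      S.card ≤ c * (m + 1) ^ d * (s + 2) ^ d

/-- **R1 PROVED (v11)**: wired BY NAME to the landed `PlanarCell.singleRelationLaw` (p611681, val-lit-p3 g14; `(c, d) = (10, 3)`). -/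
theorem stub_singleRelation : SingleRelationLaw :=
  singleRelationLaw

/-- RESIDUAL (declared LAW; = `PlanarCellBound` in the regime where the coincidences are NOT confined to ≤ 2 positions). -/
def ResidualLaw : Prop :=
  ∃ a b : ℕ, ∀ (m t : ℕ), 2 ≤ t → ∀ (u v : Fin m → MvPolynomial (Fin 2) ℂ),
    (∀ j, coeff 0 (u j) = 0 ∧ (u j).support.card ≤ t) → (∀ j, coeff 0 (v j) = 0 ∧ (v j).support.card ≤ t) →
    (¬ ∃ J : Finset (Fin m), J.card ≤ 2 ∧ Confined (fun j => (u j).support ∪ (v j).support) J) →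
    ∀ (R : Expo → Expo → Prop) (S : Finset Expo), IsCellFamily u v R S →
      S.card ≤ 2 ^ (a * m) * (t + 2) ^ b

/-- Monotonicity of `BlockSmall` in the size bound. -/
theorem blockSmall_mono {A : Fin m → Finset Expo} {J : Finset (Fin m)} {M M' : ℕ} (h : BlockSmall A J M) (hM : M ≤ M') :
    BlockSmall A J M' := by
  obtain ⟨P, hP, hmem⟩ := h
  exact ⟨P, hP.trans hM, hmem⟩

/-- SHARP RESIDUAL (v5; superseded as the cone's LAW by `ResidualLawV6` below, which it implies; WEAKER than `ResidualLaw`): `PlanarCellBound` for the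
configurations in which EVERY confining position set `J` has a LARGE block sumset (`> 2^m (t+2)^4` points) — equivalently, no
block-merge lands in the proved block law `stub_blockLaw`.  (`Confined A univ` always holds, so in particular the full sumset is
large.)  What is left: interacting relations with large blocks — structured blocks WITH cross-links, common supports, carry frames. -/
def ResidualLawSharp : Prop :=
  ∃ a b : ℕ, ∀ (m t : ℕ), 2 ≤ t → ∀ (u v : Fin m → MvPolynomial (Fin 2) ℂ),
    (∀ j, coeff 0 (u j) = 0 ∧ (u j).support.card ≤ t) → (∀ j, coeff 0 (v j) = 0 ∧ (v j).support.card ≤ t) →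
    (∀ J : Finset (Fin m), Confined (fun j => (u j).support ∪ (v j).support) J →
      ¬ BlockSmall (fun j => (u j).support ∪ (v j).support) J (2 ^ m * (t + 2) ^ 4)) →
    ∀ (R : Expo → Expo → Prop) (S : Finset Expo), IsCellFamily u v R S →
      S.card ≤ 2 ^ (a * m) * (t + 2) ^ b

/-- The sharp residual is WEAKER than the `κ ≤ 2` residual (so nothing is lost by the sharpening). -/
theorem residualLawSharp_of_residualLaw (h : ResidualLaw) : ResidualLawSharp := by
  obtain ⟨a, b, h⟩ := h
  refine ⟨a, b, ?_⟩
  intro m t ht u v hu hv hlarge R S hS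
  refine h m t ht u v hu hv ?_ R S hS
  rintro ⟨J, hJ, hconf⟩
  have hAs : ∀ j, ((u j).support ∪ (v j).support).card ≤ 2 * t := by
    intro j
    calc ((u j).support ∪ (v j).support).card ≤ (u j).support.card + (v j).support.card := Finset.card_union_le _ _
      _ ≤ t + t := Nat.add_le_add (hu j).2 (hv j).2
      _ = 2 * t := by ring
  have hsmall := blockSmall_of_card (fun j => (u j).support ∪ (v j).support) J (2 * t) hAs
  refine hlarge J hconf (blockSmall_mono hsmall ?_)
  have h1 : (2 * t + 1) ^ J.card ≤ (2 * t + 1) ^ 2 := Nat.pow_le_pow_right (by omega) hJ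
  have h2 : (2 * t + 1) ^ 2 ≤ (t + 2) ^ 4 := by
    have : 2 * t + 1 ≤ (t + 2) ^ 2 := by nlinarith
    calc (2 * t + 1) ^ 2 ≤ ((t + 2) ^ 2) ^ 2 := Nat.pow_le_pow_left this 2
      _ = (t + 2) ^ 4 := by rw [← pow_mul]
  have h3 : (t + 2) ^ 4 ≤ 2 ^ m * (t + 2) ^ 4 := Nat.le_mul_of_pos_left _ (Nat.two_pow_pos m)
  exact h1.trans (h2.trans h3)

/-- **RUNG R2 (confined law), PROVED** from the block law: `ConfinedLaw` with constants `(3, 18)`. -/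
theorem stub_confinedLaw : ConfinedLaw :=
  confinedLaw_of_blockLaw stub_blockLaw

/-! ## Witness rung κ = 0 (PROVED): confinement to no position is dissociation -/

/-- `Confined A ∅` is exactly the dissociation hypothesis `hdis` of `planarCell_dissociated_linear`. -/
theorem confined_empty_injOn (A : Fin m → Finset Expo) (h : Confined A ∅) :
    Set.InjOn (fun a : Fin m → Expo => ∑ j, a j) ↑(tuples A) := by
  intro a ha b hb hab
  funext j
  exact h a (Finset.mem_coe.1 ha) b (Finset.mem_coe.1 hb) hab j (by simp)

/-- The `κ = 0` instance of `ConfinedLaw` with the LINEAR bound `2m + 2` (p603804 by name). -/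
theorem confinedLaw_rung_zero (u v : Fin m → MvPolynomial (Fin 2) ℂ) (A : Fin m → Finset Expo)
    (hA0 : ∀ j, (0 : Expo) ∉ A j) (hu : ∀ j, (u j).support ⊆ A j) (hv : ∀ j, (v j).support ⊆ A j)
    (hconf : Confined A ∅) (R : Expo → Expo → Prop) (S : Finset Expo) (hS : IsCellFamily u v R S) :
    S.card ≤ 2 * m + 2 :=
  planarCell_dissociated_linear u v A hA0 hu hv (confined_empty_injOn A hconf) R S hS

/-! ## Quotable corollaries of the block law (crit-3 #11 P2): small FULL sumset, and `m ≤ 4` unconditionally -/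

/-- `Confined A univ` always holds (nothing is asked off `univ`). -/
theorem confined_univ (A : Fin m → Finset Expo) : Confined A Finset.univ :=
  fun _ _ _ _ _ j hj => absurd (Finset.mem_univ j) hj

/-- **Small full sumset ⇒ the planar-cell bound** (block law with `J = univ`): if every letter tuple of the instance sums into a
set of `≤ M` points then per cell `#S ≤ 2^{3m}(M + 2t + 2)^9` — for EVERY configuration, no confinement asked. -/
theorem planarCell_smallSumset (t M : ℕ) (u v : Fin m → MvPolynomial (Fin 2) ℂ)
    (hu : ∀ j, coeff 0 (u j) = 0 ∧ (u j).support.card ≤ t) (hv : ∀ j, coeff 0 (v j) = 0 ∧ (v j).support.card ≤ t)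
    (hM : BlockSmall (fun j => (u j).support ∪ (v j).support) Finset.univ M)
    (R : Expo → Expo → Prop) (S : Finset Expo) (hS : IsCellFamily u v R S) :
    S.card ≤ 2 ^ (3 * m) * (M + 2 * t + 2) ^ 9 := by
  have hA0 : ∀ j, (0 : Expo) ∉ (u j).support ∪ (v j).support := by
    intro j h
    rcases Finset.mem_union.1 h with h | h
    · exact (mem_support_iff.1 h) (hu j).1
    · exact (mem_support_iff.1 h) (hv j).1
  have hAs : ∀ j, ((u j).support ∪ (v j).support).card ≤ 2 * t := by
    intro j
    calc ((u j).support ∪ (v j).support).card ≤ (u j).support.card + (v j).support.card := Finset.card_union_le _ _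
      _ ≤ t + t := Nat.add_le_add (hu j).2 (hv j).2
      _ = 2 * t := by ring
  exact planarCell_blockLaw (2 * t) M u v (fun j => (u j).support ∪ (v j).support) Finset.univ hA0 hAs
    (fun j => Finset.subset_union_left) (fun j => Finset.subset_union_right) (confined_univ _) hM R S hS

/-- **`m ≤ 4` ⇒ the planar-cell bound UNCONDITIONALLY**: the full sumset has `≤ (2t+1)^m ≤ (2t+1)^4` points, so per cell
`#S ≤ 2^{3m}((2t+1)^4 + 2t + 2)^9` (polynomial in `t`).  Hence the line's residual lives at `m ≥ 5`. -/
theorem planarCell_of_le_four (t : ℕ) (hm : m ≤ 4) (u v : Fin m → MvPolynomial (Fin 2) ℂ)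
    (hu : ∀ j, coeff 0 (u j) = 0 ∧ (u j).support.card ≤ t) (hv : ∀ j, coeff 0 (v j) = 0 ∧ (v j).support.card ≤ t)
    (R : Expo → Expo → Prop) (S : Finset Expo) (hS : IsCellFamily u v R S) :
    S.card ≤ 2 ^ (3 * m) * ((2 * t + 1) ^ 4 + 2 * t + 2) ^ 9 := by
  have hAs : ∀ j, ((u j).support ∪ (v j).support).card ≤ 2 * t := by
    intro j
    calc ((u j).support ∪ (v j).support).card ≤ (u j).support.card + (v j).support.card := Finset.card_union_le _ _
      _ ≤ t + t := Nat.add_le_add (hu j).2 (hv j).2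
      _ = 2 * t := by ring
  have hsmall := blockSmall_of_card (fun j => (u j).support ∪ (v j).support) Finset.univ (2 * t) hAs
  have hle : (2 * t + 1) ^ (Finset.univ : Finset (Fin m)).card ≤ (2 * t + 1) ^ 4 := by
    rw [Finset.card_univ, Fintype.card_fin]; exact Nat.pow_le_pow_right (by omega) hm
  exact planarCell_smallSumset t ((2 * t + 1) ^ 4) u v hu hv (blockSmall_mono hsmall hle) R S hS

/-! ## RUNG R3 (v6): coincidences of PERMUTATION TYPE only — the tail alphabet is a `B_m`-set

If the tail alphabet `T = tailSupport u v` is a `B_m`-SET (all multisets of `≤ m` letters of `T` have distinct sums: `IsBm m T`),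
then every additive coincidence between letter tuples is of PERMUTATION TYPE (same multiset of letters placed in different
positions) — the regime of SHARED letters / cross-links / common supports, where `Confined` fails for every small block.  LEVER:
lift letters to independent variables (`Y_e`, `e ∈ T`): the planar instance is the image of the lifted one under `Y_e ↦ X^e`, and
`IsBm` makes this push-forward INJECTIVE on the lifted product support (degree `≤ m`), so a planar visible point is the strict
`θ_ξ`-minimum (`θ_ξ(e) = −wt ξ e > 0`) of the lifted support of `∏(1+U_j) − ∏(1+V_j)`; the LIFTED log-linearisation (Newton /
Wronskian congruence in `ℂ[Y_e]`, the `Fin s` port of `stub_logLinearisation`'s chain) makes it the strict `θ_ξ`-minimal UNEQUAL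
MOMENT, and the valid weights of one instance lie on one real pencil after normalising `wt ξ e₀ = −1`; so the landed
`liftedPencilCount_bound` (p595517's file) bounds the GLOBAL number of visible points by `2^{13m}(#T+2)^2`.  Not implied by
`planarCell_dissociated_linear` (shared letters break tuple-injectivity) nor by the block law (cross-links un-confine positions). -/

/-- `T ⊆ ℕ²` is a `B_h`-set in the strong sense: multisets of at most `h` letters of `T` are determined by their sums. -/
def IsBm (h : ℕ) (T : Finset Expo) : Prop :=
  ∀ ν ν' : Expo →₀ ℕ, ν.support ⊆ T → ν'.support ⊆ T →
    (ν.sum fun _ k => k) ≤ h → (ν'.sum fun _ k => k) ≤ h →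
    (ν.sum fun e k => k • e) = (ν'.sum fun e k => k • e) → ν = ν'

/-- RUNG R3 (permutation-type law; PROVED below from the `Lifted` toolkit; GLOBAL count, not per cell). -/
def PermutationTypeLaw : Prop :=
  ∀ (m : ℕ) (u v : Fin m → MvPolynomial (Fin 2) ℂ), (∀ j, coeff 0 (u j) = 0) → (∀ j, coeff 0 (v j) = 0) →
    IsBm m (tailSupport u v) →
    ∀ S : Finset Expo, (∀ l ∈ S, ∃ ξ : Fin 2 → ℝ, ValidWeight u v ξ ∧ IsStrictTop ξ ↑(tailDiff u v).support l) →
      S.card ≤ 2 ^ (13 * m) * ((tailSupport u v).card + 2) ^ 2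

/-- **R3 PROVED (v7)**: `PermutationType.permutationTypeLaw_proof`. -/
theorem stub_permutationType : PermutationTypeLaw :=
  fun m u v hu hv hBm S hS => PermutationType.permutationTypeLaw_proof m u v hu hv hBm S hS

/-- RESIDUAL v6 (declared LAW; weaker than `ResidualLawSharp`): `PlanarCellBound` for configurations in which every confining
`J` has a large block sumset AND the tail alphabet is NOT a `B_m`-set (some genuine additive relation between two distinct
multisets of `≤ m` letters exists). -/
def ResidualLawV6 : Prop :=
  ∃ a b : ℕ, ∀ (m t : ℕ), 2 ≤ t → ∀ (u v : Fin m → MvPolynomial (Fin 2) ℂ),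
    (∀ j, coeff 0 (u j) = 0 ∧ (u j).support.card ≤ t) → (∀ j, coeff 0 (v j) = 0 ∧ (v j).support.card ≤ t) →
    (∀ J : Finset (Fin m), Confined (fun j => (u j).support ∪ (v j).support) J →
      ¬ BlockSmall (fun j => (u j).support ∪ (v j).support) J (2 ^ m * (t + 2) ^ 4)) →
    ¬ IsBm m (tailSupport u v) →
    ∀ (R : Expo → Expo → Prop) (S : Finset Expo), IsCellFamily u v R S →
      S.card ≤ 2 ^ (a * m) * (t + 2) ^ b

theorem residualLawV6_of_sharp (h : ResidualLawSharp) : ResidualLawV6 := by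
  obtain ⟨a, b, h⟩ := h
  exact ⟨a, b, fun m t ht u v hu hv hlarge _ R S hS => h m t ht u v hu hv hlarge R S hS⟩

/-- `2 n ≤ 2 ^ n`. -/
theorem two_mul_le_two_pow : ∀ n : ℕ, 2 * n ≤ 2 ^ n
  | 0 => by simp
  | 1 => by simp
  | (n + 2) => by
    have ih := two_mul_le_two_pow (n + 1)
    calc 2 * (n + 2) = 2 * (n + 1) + 2 := by ring
      _ ≤ 2 ^ (n + 1) + 2 ^ (n + 1) := Nat.add_le_add ih (by
          calc (2 : ℕ) = 2 ^ 1 := by norm_num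
            _ ≤ 2 ^ (n + 1) := Nat.pow_le_pow_right (by norm_num) (by omega))
      _ = 2 ^ (n + 2) := by ring

/-- The tail alphabet has at most `2 m t` letters. -/
theorem card_tailSupport_le (u v : Fin m → MvPolynomial (Fin 2) ℂ) (t : ℕ)
    (hu : ∀ j, (u j).support.card ≤ t) (hv : ∀ j, (v j).support.card ≤ t) :
    (tailSupport u v).card ≤ 2 * m * t := by
  classical
  unfold tailSupport
  calc ((Finset.univ.biUnion fun j => (u j).support) ∪ Finset.univ.biUnion fun j => (v j).support).card
      ≤ (Finset.univ.biUnion fun j => (u j).support).card + (Finset.univ.biUnion fun j => (v j).support).card :=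
        Finset.card_union_le _ _
    _ ≤ (∑ j : Fin m, (u j).support.card) + ∑ j : Fin m, (v j).support.card :=
        Nat.add_le_add Finset.card_biUnion_le Finset.card_biUnion_le
    _ ≤ (∑ _j : Fin m, t) + ∑ _j : Fin m, t :=
        Nat.add_le_add (Finset.sum_le_sum fun j _ => hu j) (Finset.sum_le_sum fun j _ => hv j)
    _ = 2 * m * t := by simp; ring

/-- R3 per cell family, in `PlanarCellBound` currency: a `B_m` tail alphabet gives `#S ≤ 2^{15m}(t+2)^2`. -/
theorem cell_bound_of_permutationType (hP : PermutationTypeLaw) (t : ℕ) (u v : Fin m → MvPolynomial (Fin 2) ℂ)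
    (hu : ∀ j, coeff 0 (u j) = 0 ∧ (u j).support.card ≤ t) (hv : ∀ j, coeff 0 (v j) = 0 ∧ (v j).support.card ≤ t)
    (hBm : IsBm m (tailSupport u v)) (R : Expo → Expo → Prop) (S : Finset Expo) (hS : IsCellFamily u v R S) :
    S.card ≤ 2 ^ (15 * m) * (t + 2) ^ 2 := by
  have hu0 : ∀ j, coeff 0 (u j) = 0 := fun j => (hu j).1
  have hv0 : ∀ j, coeff 0 (v j) = 0 := fun j => (hv j).1
  have key := hP m u v hu0 hv0 hBm S fun l hl => by
    obtain ⟨ξ, hval, htop, -⟩ := hS l hl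
    exact ⟨ξ, hval, (stub_logLinearisation m u v hu0 hv0 ξ hval l).2 htop⟩
  have hT := card_tailSupport_le u v t (fun j => (hu j).2) (fun j => (hv j).2)
  have h1 : (tailSupport u v).card + 2 ≤ 2 ^ m * (t + 2) := by
    have h2m : 2 * m ≤ 2 ^ m := two_mul_le_two_pow m
    have hpos : 1 ≤ 2 ^ m := Nat.one_le_two_pow
    nlinarith
  calc S.card ≤ 2 ^ (13 * m) * ((tailSupport u v).card + 2) ^ 2 := key
    _ ≤ 2 ^ (13 * m) * (2 ^ m * (t + 2)) ^ 2 := Nat.mul_le_mul_left _ (Nat.pow_le_pow_left h1 2)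
    _ = 2 ^ (15 * m) * (t + 2) ^ 2 := by rw [mul_pow, ← pow_mul, ← mul_assoc, ← pow_add]; ring_nf

/-! ## RUNG R3♯ (v9, PROVED): FAMILY-LEVEL permutation type

`PermutationType.PermType A`: every additive coincidence of the letter family `A` (two `0`-filled letter tuples `a, b ∈ tuples A` with
`Σ a = Σ b`) is of PERMUTATION TYPE (`msetT a = msetT b`: the same multiset of nonzero letters).  This is «position-aware `B_m`»
(equivalent to `IsBm m A` on identical supports `A_j = A`; strictly weaker than `IsBm m T` only for heterogeneous supports): it
holds for DISSOCIATED families (`Σ` injective on tuples — p603804's hypothesis; `PermutationType.permType_of_injOn`),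
for `B_m` alphabets (R3; `permType_of_isBm` below), and for the block-merged instance of a confined family (R2⁺).  Under it the
push-forward `Y_e ↦ X^e` is injective on the support of the lifted difference (`PermutationType.injOn_of_permType`: a lifted support
point of `∏(1+U_j)` is the multiset of a letter tuple of the family), which is all the R3 count needs (`PermutationType.count_of_injOn`).
So ONE global theorem covers every rung of the ladder, and the residual becomes: large blocks AND a GENUINE (non-permutation)
coincidence inside the family. -/

/-- RUNG R3♯ (family-level permutation-type law; GLOBAL count). -/
def PermTypeLaw : Prop :=
  ∀ (m : ℕ) (u v : Fin m → MvPolynomial (Fin 2) ℂ), (∀ j, coeff 0 (u j) = 0) → (∀ j, coeff 0 (v j) = 0) →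
    PermutationType.PermType (fun j => (u j).support ∪ (v j).support) →
    ∀ S : Finset Expo, (∀ l ∈ S, ∃ ξ : Fin 2 → ℝ, ValidWeight u v ξ ∧ IsStrictTop ξ ↑(tailDiff u v).support l) →
      S.card ≤ 2 ^ (13 * m) * ((tailSupport u v).card + 2) ^ 2

/-- **R3♯ PROVED (v9)**: `PermutationType.permTypeLaw_proof`. -/
theorem stub_permType : PermTypeLaw :=
  fun m u v hu hv hperm S hS => PermutationType.permTypeLaw_proof m u v hu hv hperm S hS

/-- The weighted letter sum of a multiset, as an additive map. -/
theorem msum_eq_linearCombination (ν : Expo →₀ ℕ) :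
    (ν.sum fun e k => k • e) = Finsupp.linearCombination ℕ (fun e : Expo => e) ν :=
  (Finsupp.linearCombination_apply ℕ ν).symm

/-- The letter multiset of a tuple sums to the tuple's point. -/
theorem msum_msetT (a : Fin m → Expo) : ((PermutationType.msetT a).sum fun e k => k • e) = ∑ j, a j := by
  rw [msum_eq_linearCombination]
  unfold PermutationType.msetT
  rw [map_sum]
  refine Finset.sum_congr rfl fun j _ => ?_
  by_cases h : a j = 0
  · rw [if_pos h, map_zero, h]
  · rw [if_neg h, Finsupp.linearCombination_single, one_smul]

/-- The letter multiset of a tuple has at most `m` letters. -/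
theorem degree_msetT_le (a : Fin m → Expo) : ((PermutationType.msetT a).sum fun _ k => k) ≤ m := by
  have hdeg : ∀ ν : Expo →₀ ℕ, (ν.sum fun _ k => k) = Finsupp.degree ν := fun ν => rfl
  rw [hdeg]
  unfold PermutationType.msetT
  rw [map_sum]
  calc ∑ j, Finsupp.degree (if a j = 0 then (0 : Expo →₀ ℕ) else Finsupp.single (a j) 1) ≤ ∑ _j : Fin m, 1 :=
        Finset.sum_le_sum fun j _ => by
          by_cases h : a j = 0
          · rw [if_pos h, map_zero]; exact Nat.zero_le _
          · rw [if_neg h, Finsupp.degree_single]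
    _ = m := by simp

/-- The letter multiset of a tuple of the family is supported on the tail alphabet. -/
theorem support_msetT_subset (u v : Fin m → MvPolynomial (Fin 2) ℂ) (a : Fin m → Expo)
    (ha : a ∈ tuples (fun j => (u j).support ∪ (v j).support)) :
    (PermutationType.msetT a).support ⊆ tailSupport u v := by
  classical
  intro e he
  unfold PermutationType.msetT at he
  obtain ⟨j, -, hj⟩ := Finset.mem_biUnion.1 (Finsupp.support_finsetSum he)
  by_cases h : a j = 0
  · rw [if_pos h] at hj; simp at hj
  · rw [if_neg h] at hj
    have he' : e = a j := by
      have := Finsupp.support_single_subset hj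
      simpa using this
    have haj : a j ∈ insert (0 : Expo) ((u j).support ∪ (v j).support) := Fintype.mem_piFinset.1 ha j
    rcases Finset.mem_insert.1 haj with h0 | hmem
    · exact absurd h0 h
    · rw [he']
      unfold tailSupport
      rcases Finset.mem_union.1 hmem with hu | hv
      · exact Finset.mem_union_left _ (Finset.mem_biUnion.2 ⟨j, Finset.mem_univ _, hu⟩)
      · exact Finset.mem_union_right _ (Finset.mem_biUnion.2 ⟨j, Finset.mem_univ _, hv⟩)

/-- A `B_m` tail alphabet makes the family of permutation type (so R3♯ ⊇ R3). -/
theorem permType_of_isBm (u v : Fin m → MvPolynomial (Fin 2) ℂ) (hBm : IsBm m (tailSupport u v)) :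
    PermutationType.PermType (fun j => (u j).support ∪ (v j).support) := by
  intro a ha b hb hab
  refine hBm _ _ (support_msetT_subset u v a ha) (support_msetT_subset u v b hb) (degree_msetT_le a) (degree_msetT_le b) ?_
  rw [msum_msetT, msum_msetT, hab]

/-- RESIDUAL v9 (declared LAW; weaker than `ResidualLawV6`): `PlanarCellBound` for configurations in which every confining `J`
has a large block sumset AND the letter family carries a GENUINE (non-permutation) coincidence. -/
def ResidualLawV9 : Prop :=
  ∃ a b : ℕ, ∀ (m t : ℕ), 2 ≤ t → ∀ (u v : Fin m → MvPolynomial (Fin 2) ℂ),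
    (∀ j, coeff 0 (u j) = 0 ∧ (u j).support.card ≤ t) → (∀ j, coeff 0 (v j) = 0 ∧ (v j).support.card ≤ t) →
    (∀ J : Finset (Fin m), Confined (fun j => (u j).support ∪ (v j).support) J →
      ¬ BlockSmall (fun j => (u j).support ∪ (v j).support) J (2 ^ m * (t + 2) ^ 4)) →
    ¬ PermutationType.PermType (fun j => (u j).support ∪ (v j).support) →
    ∀ (R : Expo → Expo → Prop) (S : Finset Expo), IsCellFamily u v R S →
      S.card ≤ 2 ^ (a * m) * (t + 2) ^ b

/-- The v9 residual is WEAKER than the v6 one (hence than `ResidualLawSharp` and `ResidualLaw`). -/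
theorem residualLawV9_of_V6 (h : ResidualLawV6) : ResidualLawV9 := by
  obtain ⟨a, b, h⟩ := h
  exact ⟨a, b, fun m t ht u v hu hv hlarge hnp R S hS =>
    h m t ht u v hu hv hlarge (fun hBm => hnp (permType_of_isBm u v hBm)) R S hS⟩

/-- Per cell-family form of R3♯: `#S ≤ 2^{15m}(t+2)^2`. -/
theorem cell_bound_of_permType (hP : PermTypeLaw) (t : ℕ) (u v : Fin m → MvPolynomial (Fin 2) ℂ)
    (hu : ∀ j, coeff 0 (u j) = 0 ∧ (u j).support.card ≤ t) (hv : ∀ j, coeff 0 (v j) = 0 ∧ (v j).support.card ≤ t)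
    (hperm : PermutationType.PermType (fun j => (u j).support ∪ (v j).support)) (R : Expo → Expo → Prop) (S : Finset Expo)
    (hS : IsCellFamily u v R S) :
    S.card ≤ 2 ^ (15 * m) * (t + 2) ^ 2 := by
  have hu0 : ∀ j, coeff 0 (u j) = 0 := fun j => (hu j).1
  have hv0 : ∀ j, coeff 0 (v j) = 0 := fun j => (hv j).1
  have key := hP m u v hu0 hv0 hperm S fun l hl => by
    obtain ⟨ξ, hval, htop, -⟩ := hS l hl
    exact ⟨ξ, hval, (stub_logLinearisation m u v hu0 hv0 ξ hval l).2 htop⟩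
  have hT := card_tailSupport_le u v t (fun j => (hu j).2) (fun j => (hv j).2)
  have h1 : (tailSupport u v).card + 2 ≤ 2 ^ m * (t + 2) := by
    have h2m : 2 * m ≤ 2 ^ m := two_mul_le_two_pow m
    have hpos : 1 ≤ 2 ^ m := Nat.one_le_two_pow
    nlinarith
  calc S.card ≤ 2 ^ (13 * m) * ((tailSupport u v).card + 2) ^ 2 := key
    _ ≤ 2 ^ (13 * m) * (2 ^ m * (t + 2)) ^ 2 := Nat.mul_le_mul_left _ (Nat.pow_le_pow_left h1 2)
    _ = 2 ^ (15 * m) * (t + 2) ^ 2 := by rw [mul_pow, ← pow_mul, ← mul_assoc, ← pow_add]; ring_nf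

/-- **GLOBAL linear-family bound for DISSOCIATED families** (p603804 was per cell): `#visible ≤ 2^{13m}(#T+2)^2`. -/
theorem visible_global_of_dissociated (u v : Fin m → MvPolynomial (Fin 2) ℂ) (hu : ∀ j, coeff 0 (u j) = 0)
    (hv : ∀ j, coeff 0 (v j) = 0)
    (hdis : Set.InjOn (fun a : Fin m → Expo => ∑ j, a j) ↑(tuples fun j => (u j).support ∪ (v j).support))
    (S : Finset Expo) (hS : ∀ l ∈ S, ∃ ξ : Fin 2 → ℝ, ValidWeight u v ξ ∧ IsStrictTop ξ ↑(tailDiff u v).support l) :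
    S.card ≤ 2 ^ (13 * m) * ((tailSupport u v).card + 2) ^ 2 :=
  stub_permType m u v hu hv (PermutationType.permType_of_injOn _ hdis) S hS

/-! ## RUNG R5 (v10, PROVED): MERGED permutation type — one lattice-small block absorbs the genuine relations

R3♯ and R2⁺ are two faces of ONE statement.  Contract a block of positions `J ∋ j₀` to the single position `j₀`
(`merge`, landed p607798: position `j₀` carries `∏_{i∈J}(1+u_i) − 1`, the rest of `J` carries `0`): `tailDiff` is unchanged
(`tailDiff_merge`), valid weights stay valid (`validWeight_merge`), and the merged letter family is `mergeA A J j₀` (block sums at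
`j₀`).  If the block sumset has `≤ M` points (`BlockSmall`) and the MERGED family is of permutation type, R3♯ applied to the merged
instance gives GLOBALLY `#visible ≤ 2^{13m}(M + m s + 2)^2`.  `J = {j₀}` is R3♯ itself (`mergeA A {j₀} j₀ ⊆ A`); a CONFINED `J`
has a dissociated merged family (`injOn_mergeA`), hence a permutation-type one — that is R2⁺, now global and with exponent 2.
NEW instances covered: a structured small block (genuine relations inside `J`) sitting in a family that shares letters ACROSS the
other positions (not confined, but every coincidence of the merged family is a permutation).  Residual v10: NO block `J ∋ j₀` with
small sumset makes the merged family permutation-type. -/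

/-- `PermutationType.PermType` is antitone in the letter family. -/
theorem permType_mono {A A' : Fin m → Finset Expo} (h : ∀ j, A' j ⊆ A j) (hP : PermutationType.PermType A) :
    PermutationType.PermType A' := by
  intro a ha b hb hab
  have hsub : tuples A' ⊆ tuples A := fun c hc =>
    Fintype.mem_piFinset.2 fun j => Finset.insert_subset_insert _ (h j) (Fintype.mem_piFinset.1 hc j)
  exact hP a (hsub ha) b (hsub hb) hab

/-- Merging a singleton block does not enlarge the letter family. -/
theorem mergeA_singleton_subset (A : Fin m → Finset Expo) (j₀ j : Fin m) : mergeA A {j₀} j₀ j ⊆ A j := by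
  classical
  unfold mergeA
  split_ifs with h1 h2
  · subst h1
    intro e he
    obtain ⟨hne, hmem⟩ := Finset.mem_erase.1 he
    unfold blockSet at hmem
    obtain ⟨a, ha, hsum⟩ := Finset.mem_image.1 hmem
    rw [Finset.sum_singleton] at hsum
    have haj : a j ∈ insert (0 : Expo) (A j) := Fintype.mem_piFinset.1 ha j
    rw [hsum] at haj
    rcases Finset.mem_insert.1 haj with h0 | h
    · exact absurd h0 hne
    · exact h
  · exact absurd (Finset.mem_singleton.1 h2) h1
  · exact fun e he => he

/-- A confined block has a permutation-type merged family (R2⁺'s regime inside R5). -/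
theorem permType_mergeA_of_confined (A : Fin m → Finset Expo) (J : Finset (Fin m)) (j₀ : Fin m) (hj₀ : j₀ ∈ J)
    (hconf : Confined A J) : PermutationType.PermType (mergeA A J j₀) :=
  PermutationType.permType_of_injOn _ (injOn_mergeA A J j₀ hj₀ hconf)

/-- `Confined A ∅` is dissociation, hence permutation type. -/
theorem permType_of_confined_empty (A : Fin m → Finset Expo) (hconf : Confined A ∅) : PermutationType.PermType A := by
  refine PermutationType.permType_of_injOn A fun a ha b hb hab => ?_
  exact funext fun j => hconf a (Finset.mem_coe.1 ha) b (Finset.mem_coe.1 hb) hab j (Finset.notMem_empty j)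

/-- **R5 (merged permutation type), from R3♯.** -/
theorem visible_of_mergedPermType (hP : PermTypeLaw) (s M : ℕ) (u v : Fin m → MvPolynomial (Fin 2) ℂ)
    (A : Fin m → Finset Expo) (J : Finset (Fin m)) (j₀ : Fin m) (hj₀ : j₀ ∈ J) (hA0 : ∀ j, (0 : Expo) ∉ A j)
    (hAs : ∀ j, (A j).card ≤ s) (hu : ∀ j, (u j).support ⊆ A j) (hv : ∀ j, (v j).support ⊆ A j)
    (hB : BlockSmall A J M) (hperm : PermutationType.PermType (mergeA A J j₀)) (S : Finset Expo)
    (hS : ∀ l ∈ S, ∃ ξ : Fin 2 → ℝ, ValidWeight u v ξ ∧ IsStrictTop ξ ↑(tailDiff u v).support l) :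
    S.card ≤ 2 ^ (13 * m) * (M + m * s + 2) ^ 2 := by
  have hu0 : ∀ j, coeff 0 (u j) = 0 := fun j => notMem_support_iff.1 fun h => hA0 j (hu j h)
  have hv0 : ∀ j, coeff 0 (v j) = 0 := fun j => notMem_support_iff.1 fun h => hA0 j (hv j h)
  have hu0' : ∀ j, coeff 0 (merge u J j₀ j) = 0 := coeff_zero_merge u J j₀ hu0
  have hv0' : ∀ j, coeff 0 (merge v J j₀ j) = 0 := coeff_zero_merge v J j₀ hv0
  have hperm' : PermutationType.PermType (fun j => (merge u J j₀ j).support ∪ (merge v J j₀ j).support) :=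
    permType_mono (fun j => Finset.union_subset (support_merge_subset u A J j₀ hj₀ hA0 hu j)
      (support_merge_subset v A J j₀ hj₀ hA0 hv j)) hperm
  have hS' : ∀ l ∈ S, ∃ ξ : Fin 2 → ℝ, ValidWeight (merge u J j₀) (merge v J j₀) ξ ∧
      IsStrictTop ξ ↑(tailDiff (merge u J j₀) (merge v J j₀)).support l := fun l hl => by
    obtain ⟨ξ, hval, htop⟩ := hS l hl
    exact ⟨ξ, validWeight_merge u v J j₀ hj₀ hu0 hv0 hval, by rw [tailDiff_merge u v J j₀ hj₀]; exact htop⟩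
  have key := hP m (merge u J j₀) (merge v J j₀) hu0' hv0' hperm' S hS'
  have hT := card_tailSupport_merge_le u v A J j₀ hj₀ hA0 hu hv M s hAs hB
  calc S.card ≤ 2 ^ (13 * m) * ((tailSupport (merge u J j₀) (merge v J j₀)).card + 2) ^ 2 := key
    _ ≤ 2 ^ (13 * m) * (M + m * s + 2) ^ 2 := Nat.mul_le_mul_left _ (Nat.pow_le_pow_left (by omega) 2)

/-- RUNG R5 as a law (global count; `M` = block sumset size, `s` = letters per position). -/
def MergedPermTypeLaw : Prop :=
  ∀ (m s M : ℕ) (u v : Fin m → MvPolynomial (Fin 2) ℂ) (A : Fin m → Finset Expo) (J : Finset (Fin m)) (j₀ : Fin m),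
    j₀ ∈ J → (∀ j, (0 : Expo) ∉ A j) → (∀ j, (A j).card ≤ s) → (∀ j, (u j).support ⊆ A j) →
    (∀ j, (v j).support ⊆ A j) → BlockSmall A J M → PermutationType.PermType (mergeA A J j₀) →
    ∀ S : Finset Expo, (∀ l ∈ S, ∃ ξ : Fin 2 → ℝ, ValidWeight u v ξ ∧ IsStrictTop ξ ↑(tailDiff u v).support l) →
      S.card ≤ 2 ^ (13 * m) * (M + m * s + 2) ^ 2

/-- **R5 PROVED (v10)** from R3♯ (`stub_permType`) and the landed merge toolkit (p607798). -/
theorem stub_mergedPermType : MergedPermTypeLaw :=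
  fun _m s M u v A J j₀ hj₀ hA0 hAs hu hv hB hperm S hS =>
    visible_of_mergedPermType stub_permType s M u v A J j₀ hj₀ hA0 hAs hu hv hB hperm S hS

/-- R2⁺'s regime recovered from R5, GLOBALLY and with exponent `2`: confined block with small sumset. -/
theorem visible_global_of_confined_blockSmall (s M : ℕ) (u v : Fin m → MvPolynomial (Fin 2) ℂ)
    (A : Fin m → Finset Expo) (J : Finset (Fin m)) (j₀ : Fin m) (hj₀ : j₀ ∈ J) (hA0 : ∀ j, (0 : Expo) ∉ A j)
    (hAs : ∀ j, (A j).card ≤ s) (hu : ∀ j, (u j).support ⊆ A j) (hv : ∀ j, (v j).support ⊆ A j)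
    (hconf : Confined A J) (hB : BlockSmall A J M) (S : Finset Expo)
    (hS : ∀ l ∈ S, ∃ ξ : Fin 2 → ℝ, ValidWeight u v ξ ∧ IsStrictTop ξ ↑(tailDiff u v).support l) :
    S.card ≤ 2 ^ (13 * m) * (M + m * s + 2) ^ 2 :=
  stub_mergedPermType m s M u v A J j₀ hj₀ hA0 hAs hu hv hB (permType_mergeA_of_confined A J j₀ hj₀ hconf) S hS

/-- Arithmetic for the v10 composition. -/
theorem merged_arith (m t : ℕ) :
    2 ^ (13 * m) * (2 ^ m * (t + 2) ^ 4 + m * (2 * t) + 2) ^ 2 ≤ 2 ^ (15 * m) * (t + 2) ^ 10 := by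
  have h2m : 2 * m ≤ 2 ^ m := two_mul_le_two_pow m
  have hpos : 1 ≤ 2 ^ m := Nat.one_le_two_pow
  have hq : 2 * t + 2 ≤ (t + 2) ^ 4 := by
    have h1 : 2 * t + 2 ≤ (t + 2) ^ 2 := by nlinarith
    exact h1.trans (Nat.pow_le_pow_right (by omega) (by norm_num))
  have h1 : m * (2 * t) + 2 ≤ 2 ^ m * (2 * t + 2) := by nlinarith
  have h2 : 2 ^ m * (2 * t + 2) ≤ 2 ^ m * (t + 2) ^ 4 := Nat.mul_le_mul_left _ hq
  have hX : 2 ^ m * (t + 2) ^ 4 + m * (2 * t) + 2 ≤ 2 ^ m * (2 * (t + 2) ^ 4) := by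
    have h3 : 2 ^ m * (2 * (t + 2) ^ 4) = 2 ^ m * (t + 2) ^ 4 + 2 ^ m * (t + 2) ^ 4 := by ring
    rw [h3]; linarith
  have h4 : (4 : ℕ) ≤ (t + 2) ^ 2 := by nlinarith
  calc 2 ^ (13 * m) * (2 ^ m * (t + 2) ^ 4 + m * (2 * t) + 2) ^ 2
      ≤ 2 ^ (13 * m) * (2 ^ m * (2 * (t + 2) ^ 4)) ^ 2 := Nat.mul_le_mul_left _ (Nat.pow_le_pow_left hX 2)
    _ = 2 ^ (15 * m) * (4 * (t + 2) ^ 8) := by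
        rw [mul_pow, mul_pow, ← pow_mul, ← pow_mul, ← mul_assoc, ← pow_add]; ring_nf
    _ ≤ 2 ^ (15 * m) * ((t + 2) ^ 2 * (t + 2) ^ 8) := Nat.mul_le_mul_left _ (Nat.mul_le_mul_right _ h4)
    _ = 2 ^ (15 * m) * (t + 2) ^ 10 := by rw [← pow_add]

/-- Per cell-family form of R5 with the cone's block threshold `M₀ = 2^m (t+2)^4`: `#S ≤ 2^{15m}(t+2)^{10}`. -/
theorem cell_bound_of_mergedPermType (hP : PermTypeLaw) (t : ℕ) (u v : Fin m → MvPolynomial (Fin 2) ℂ)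
    (hu : ∀ j, coeff 0 (u j) = 0 ∧ (u j).support.card ≤ t) (hv : ∀ j, coeff 0 (v j) = 0 ∧ (v j).support.card ≤ t)
    (J : Finset (Fin m)) (j₀ : Fin m) (hj₀ : j₀ ∈ J)
    (hB : BlockSmall (fun j => (u j).support ∪ (v j).support) J (2 ^ m * (t + 2) ^ 4))
    (hperm : PermutationType.PermType (mergeA (fun j => (u j).support ∪ (v j).support) J j₀))
    (R : Expo → Expo → Prop) (S : Finset Expo) (hS : IsCellFamily u v R S) :
    S.card ≤ 2 ^ (15 * m) * (t + 2) ^ 10 := by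
  have hu0 : ∀ j, coeff 0 (u j) = 0 := fun j => (hu j).1
  have hv0 : ∀ j, coeff 0 (v j) = 0 := fun j => (hv j).1
  have hA0 : ∀ j, (0 : Expo) ∉ (u j).support ∪ (v j).support := by
    intro j h
    rcases Finset.mem_union.1 h with h | h
    · exact (MvPolynomial.mem_support_iff.1 h) (hu j).1
    · exact (MvPolynomial.mem_support_iff.1 h) (hv j).1
  have hAs : ∀ j, ((u j).support ∪ (v j).support).card ≤ 2 * t := by
    intro j
    calc ((u j).support ∪ (v j).support).card ≤ (u j).support.card + (v j).support.card := Finset.card_union_le _ _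
      _ ≤ t + t := Nat.add_le_add (hu j).2 (hv j).2
      _ = 2 * t := by ring
  have hvis : ∀ l ∈ S, ∃ ξ : Fin 2 → ℝ, ValidWeight u v ξ ∧ IsStrictTop ξ ↑(tailDiff u v).support l := fun l hl => by
    obtain ⟨ξ, hval, htop, -⟩ := hS l hl
    exact ⟨ξ, hval, (stub_logLinearisation m u v hu0 hv0 ξ hval l).2 htop⟩
  have key := visible_of_mergedPermType hP (2 * t) (2 ^ m * (t + 2) ^ 4) u v (fun j => (u j).support ∪ (v j).support)
    J j₀ hj₀ hA0 hAs (fun _ => Finset.subset_union_left) (fun _ => Finset.subset_union_right) hB hperm S hvis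
  exact key.trans (merged_arith m t)

/-- RESIDUAL v10 (declared LAW; weaker than `ResidualLawV9`): `PlanarCellBound` for configurations in which NO block
`J ∋ j₀` with sumset `≤ 2^m (t+2)^4` has a permutation-type merged family — every lattice-small contraction leaves a genuine
(non-permutation) additive coincidence. -/
def ResidualLawV10 : Prop :=
  ∃ a b : ℕ, ∀ (m t : ℕ), 2 ≤ t → ∀ (u v : Fin m → MvPolynomial (Fin 2) ℂ),
    (∀ j, coeff 0 (u j) = 0 ∧ (u j).support.card ≤ t) → (∀ j, coeff 0 (v j) = 0 ∧ (v j).support.card ≤ t) →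
    (∀ (J : Finset (Fin m)) (j₀ : Fin m), j₀ ∈ J →
      BlockSmall (fun j => (u j).support ∪ (v j).support) J (2 ^ m * (t + 2) ^ 4) →
      ¬ PermutationType.PermType (mergeA (fun j => (u j).support ∪ (v j).support) J j₀)) →
    ∀ (R : Expo → Expo → Prop) (S : Finset Expo), IsCellFamily u v R S →
      S.card ≤ 2 ^ (a * m) * (t + 2) ^ b

/-- With no factor pairs there are no visible points. -/
theorem card_eq_zero_of_m_zero (u v : Fin 0 → MvPolynomial (Fin 2) ℂ) (R : Expo → Expo → Prop) (S : Finset Expo)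
    (hS : IsCellFamily u v R S) : S.card = 0 := by
  rw [Finset.card_eq_zero, Finset.eq_empty_iff_forall_notMem]
  intro l hl
  obtain ⟨ξ, hval, htop, -⟩ := hS l hl
  have htop' := (stub_logLinearisation 0 u v (fun j => Fin.elim0 j) (fun j => Fin.elim0 j) ξ hval l).2 htop
  have h0 : tailDiff u v = 0 := by simp [tailDiff]
  have := htop'.1
  rw [h0, MvPolynomial.support_zero] at this
  simp at this

/-- The v10 residual is WEAKER than the v9 one (hence than V6, Sharp and the original). -/
theorem residualLawV10_of_V9 (h : ResidualLawV9) : ResidualLawV10 := by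
  obtain ⟨a, b, h⟩ := h
  refine ⟨a, b, ?_⟩
  intro m t ht u v hu hv h10 R S hS
  rcases Nat.eq_zero_or_pos m with rfl | hm
  · rw [card_eq_zero_of_m_zero u v R S hS]; exact Nat.zero_le _
  have hAs : ∀ j, ((u j).support ∪ (v j).support).card ≤ 2 * t := by
    intro j
    calc ((u j).support ∪ (v j).support).card ≤ (u j).support.card + (v j).support.card := Finset.card_union_le _ _
      _ ≤ t + t := Nat.add_le_add (hu j).2 (hv j).2
      _ = 2 * t := by ring
  -- a singleton block is always lattice-small
  have hsingle : ∀ j₀ : Fin m, BlockSmall (fun j => (u j).support ∪ (v j).support) {j₀} (2 ^ m * (t + 2) ^ 4) := by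
    intro j₀
    have h1 := blockSmall_of_card (fun j => (u j).support ∪ (v j).support) {j₀} (2 * t) hAs
    rw [Finset.card_singleton, pow_one] at h1
    refine blockSmall_mono h1 ?_
    have hpos : 1 ≤ 2 ^ m := Nat.one_le_two_pow
    have hq : 2 * t + 1 ≤ (t + 2) ^ 4 := by
      have h2 : 2 * t + 1 ≤ (t + 2) ^ 2 := by nlinarith
      exact h2.trans (Nat.pow_le_pow_right (by omega) (by norm_num))
    nlinarith
  have hnp : ¬ PermutationType.PermType (fun j => (u j).support ∪ (v j).support) := by
    intro hP
    have j₀ : Fin m := ⟨0, hm⟩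
    exact h10 {j₀} j₀ (Finset.mem_singleton_self _) (hsingle j₀)
      (permType_mono (mergeA_singleton_subset _ j₀) hP)
  have hlarge : ∀ J : Finset (Fin m), Confined (fun j => (u j).support ∪ (v j).support) J →
      ¬ BlockSmall (fun j => (u j).support ∪ (v j).support) J (2 ^ m * (t + 2) ^ 4) := by
    intro J hconf hsmall
    rcases J.eq_empty_or_nonempty with rfl | ⟨j₀, hj₀⟩
    · exact hnp (permType_of_confined_empty _ hconf)
    · exact h10 J j₀ hj₀ hsmall (permType_mergeA_of_confined _ J j₀ hj₀ hconf)
  exact h m t ht u v hu hv hlarge hnp R S hS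

/-! ## RUNG R1_r (v12, PROVED by val-lit-p3 g14, wired by name): FEW RELATION CLASSES, t-FREE

`PlanarCell.planarCell_relationClasses` (p613574, with p613530 `fibre_transport` prelim and p612132 `…SingleRelationTFree`):
if the coincidences of the letter family are covered by `r` RELATION CLASSES (class `k` = a position set `Jc k` carrying one fixed
exchange `ac k ↔ bc k`), then per cell `#S ≤ 2(m+1)·(3(2+m+C(m,2))²)^r` — no sparsity hypothesis at all (`r = 0` dissociated,
`r = 1` = R1 t-free).  COMPLEMENTARY to R3♯/R5: the lifted no-fibre method quotients out PERMUTATION-type coincidences and dies on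
one genuine relation; the class count handles few POSITION-RIGID classes (genuine or not) and dies on many (identical supports
have all transpositions as classes).  The cone takes the sub-case where such a cover is CHEAP (`2(m+1)(3(2+m+C(m,2))²)^r ≤
2^m(t+2)^4`); the residual v12 adds «no cheap class cover».  The located first residual instance (identical generic supports of
32 letters, m = 10, one planted relation) has BOTH many permutation classes and a genuine relation — neither lever applies, so
R1_r does NOT exhaust the residual. -/

/-- The coincidences of `A` are covered by the `r` relation classes `(Jc k, ac k ↔ bc k)`. -/
def ClassCover (A : Fin m → Finset Expo) {r : ℕ} (Jc : Fin r → Finset (Fin m)) (ac bc : Fin r → Fin m → Expo) : Prop :=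
  ∀ a ∈ tuples A, ∀ b ∈ tuples A, a ≠ b → ∑ j, a j = ∑ j, b j →
    ∃ k : Fin r, (∀ j, a j ≠ b j ↔ j ∈ Jc k) ∧
      ((∀ j ∈ Jc k, a j = ac k j ∧ b j = bc k j) ∨ (∀ j ∈ Jc k, a j = bc k j ∧ b j = ac k j))

/-- RUNG R1_r as a law (t-free class count). -/
def RelationClassesLaw : Prop :=
  ∀ (m : ℕ) (u v : Fin m → MvPolynomial (Fin 2) ℂ) (A : Fin m → Finset Expo),
    (∀ j, (0 : Expo) ∉ A j) → (∀ j, (u j).support ⊆ A j) → (∀ j, (v j).support ⊆ A j) →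
    ∀ (r : ℕ) (Jc : Fin r → Finset (Fin m)) (ac bc : Fin r → Fin m → Expo), ClassCover A Jc ac bc →
    ∀ (R : Expo → Expo → Prop) (S : Finset Expo), IsCellFamily u v R S →
      S.card ≤ 2 * (m + 1) * (3 * (2 + m + m.choose 2) ^ 2) ^ r

/-- **R1_r PROVED (v12)**: wired BY NAME to the landed `PlanarCell.planarCell_relationClasses` (p613574, val-lit-p3 g14). -/
theorem stub_relationClasses : RelationClassesLaw :=
  fun _m u v A hA0 huA hvA _r Jc ac bc hcov R S hS => planarCell_relationClasses u v A hA0 huA hvA Jc ac bc hcov R S hS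

/-- RESIDUAL v12 (declared LAW; weaker than `ResidualLawV10`): additionally NO CHEAP CLASS COVER — every cover of the coincidences
by relation classes has `2(m+1)(3(2+m+C(m,2))²)^r > 2^m(t+2)^4`. -/
def ResidualLawV12 : Prop :=
  ∃ a b : ℕ, ∀ (m t : ℕ), 2 ≤ t → ∀ (u v : Fin m → MvPolynomial (Fin 2) ℂ),
    (∀ j, coeff 0 (u j) = 0 ∧ (u j).support.card ≤ t) → (∀ j, coeff 0 (v j) = 0 ∧ (v j).support.card ≤ t) →
    (∀ (J : Finset (Fin m)) (j₀ : Fin m), j₀ ∈ J →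
      BlockSmall (fun j => (u j).support ∪ (v j).support) J (2 ^ m * (t + 2) ^ 4) →
      ¬ PermutationType.PermType (mergeA (fun j => (u j).support ∪ (v j).support) J j₀)) →
    (∀ (r : ℕ) (Jc : Fin r → Finset (Fin m)) (ac bc : Fin r → Fin m → Expo),
      ClassCover (fun j => (u j).support ∪ (v j).support) Jc ac bc →
      2 ^ m * (t + 2) ^ 4 < 2 * (m + 1) * (3 * (2 + m + m.choose 2) ^ 2) ^ r) →
    ∀ (R : Expo → Expo → Prop) (S : Finset Expo), IsCellFamily u v R S →
      S.card ≤ 2 ^ (a * m) * (t + 2) ^ b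

/-- The v12 residual is WEAKER than the v10 one. -/
theorem residualLawV12_of_V10 (h : ResidualLawV10) : ResidualLawV12 := by
  obtain ⟨a, b, h⟩ := h
  exact ⟨a, b, fun m t ht u v hu hv h10 _ R S hS => h m t ht u v hu hv h10 R S hS⟩

/-- Per cell-family form of R1_r under a CHEAP class cover: `#S ≤ 2^m (t+2)^4`. -/
theorem cell_bound_of_cheapCover (hC : RelationClassesLaw) (t : ℕ) (u v : Fin m → MvPolynomial (Fin 2) ℂ)
    (hu : ∀ j, coeff 0 (u j) = 0 ∧ (u j).support.card ≤ t) (hv : ∀ j, coeff 0 (v j) = 0 ∧ (v j).support.card ≤ t)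
    {r : ℕ} (Jc : Fin r → Finset (Fin m)) (ac bc : Fin r → Fin m → Expo)
    (hcov : ClassCover (fun j => (u j).support ∪ (v j).support) Jc ac bc)
    (hcheap : 2 * (m + 1) * (3 * (2 + m + m.choose 2) ^ 2) ^ r ≤ 2 ^ m * (t + 2) ^ 4)
    (R : Expo → Expo → Prop) (S : Finset Expo) (hS : IsCellFamily u v R S) :
    S.card ≤ 2 ^ m * (t + 2) ^ 4 := by
  have hA0 : ∀ j, (0 : Expo) ∉ (u j).support ∪ (v j).support := by
    intro j h
    rcases Finset.mem_union.1 h with h | h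
    · exact (MvPolynomial.mem_support_iff.1 h) (hu j).1
    · exact (MvPolynomial.mem_support_iff.1 h) (hv j).1
  exact (hC m u v _ hA0 (fun _ => Finset.subset_union_left) (fun _ => Finset.subset_union_right) r Jc ac bc hcov R S hS).trans
    hcheap

/-! ## RUNG R6 (v14): FOUR-TERM RANK ONE — the PROVED SPLIT `BinExpPencilCount → RankOneFourLaw`
The first GENUINE-RELATION rung with SHARED letters: if ALL additive coincidences of the family `A_j = supp u_j ∪ supp v_j` are, on letter
multisets, multiples of ONE four-term relation `α + β = γ + δ` among pairwise distinct letters (`RankOneCoincidences`), then GLOBALLY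
`#visible ≤ 2^{cm}(#T+2)^c`.  Module `Lines/relation_ladder_R6.lean` @1dcc86cce347 (engine memo `…R6_engine.md` rev 3, tool interface
`…R6_tool.lean` rev 2): free lift `Y_δ ↦ Y_α Y_β / Y_γ`-type normal forms, toric Lemma A, ONE slicing, binomial pencil count
(`BinExpSum.binExpPencilCount`, p620797, val-lit-p3 g14) BY NAME; THEOREM via the landed port p624287 `PermutationType.rankOneFourLaw_proof`
(full text of this docstring: git ≤ v19 @bc7a63357f94). -/

/-- **R6 — the four-term rank-one law** (statement text = the R6 module's `RankOneFourLaw`, character-identical; the Theorems port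
states it by literal body, R3♯ convention). -/
def RankOneFourLaw : Prop :=
  ∃ c : ℕ, ∀ (m : ℕ) (u v : Fin m → MvPolynomial (Fin 2) ℂ), (∀ j, coeff 0 (u j) = 0) → (∀ j, coeff 0 (v j) = 0) →
    (∃ α β γ δ : Expo, α ≠ β ∧ α ≠ γ ∧ α ≠ δ ∧ β ≠ γ ∧ β ≠ δ ∧ γ ≠ δ ∧ α + β = γ + δ ∧
      PermutationType.RankOneCoincidences (fun j => (u j).support ∪ (v j).support)
        (Finsupp.single γ 1 + Finsupp.single δ 1) (Finsupp.single α 1 + Finsupp.single β 1)) →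
    ∀ S : Finset Expo, (∀ l ∈ S, ∃ ξ : Fin 2 → ℝ, ValidWeight u v ξ ∧ IsStrictTop ξ ↑(tailDiff u v).support l) →
      S.card ≤ 2 ^ (c * m) * ((tailSupport u v).card + 2) ^ c

/-- **R6 (four-term rank-one law) — THEOREM, wired BY NAME** to the LANDED Theorems port ✓ p624287
`…NewtonUnitEquationsTwoProductsRankOneFourLawCount :: PermutationType.rankOneFourLaw_proof` (val-lit-p3 g14; six files
`…RankOneFourLaw{Toric,Fibres,Slice,Planar,Weights,Count}`, literal port of `Lines/relation_ladder_R6.lean` @1dcc86cce347, tool fed by name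
from ✓ p620797 `BinExpSum.binExpPencilCount`; axioms standard). -/
theorem stub_rankOneFour : RankOneFourLaw :=
  PermutationType.rankOneFourLaw_proof

/-- A four-term DISTINCT-letter rank-one witness for a letter family (the hypothesis of R6). -/
def FourTermRankOne (A : Fin m → Finset Expo) : Prop :=
  ∃ α β γ δ : Expo, α ≠ β ∧ α ≠ γ ∧ α ≠ δ ∧ β ≠ γ ∧ β ≠ δ ∧ γ ≠ δ ∧ α + β = γ + δ ∧
    PermutationType.RankOneCoincidences A (Finsupp.single γ 1 + Finsupp.single δ 1)
      (Finsupp.single α 1 + Finsupp.single β 1)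

/-- Token-identity certificate (val-neg-1 g2 pre-audit §2): the residual's exclusion clause IS R6's hypothesis. -/
theorem fourTermRankOne_iff (A : Fin m → Finset Expo) :
    FourTermRankOne A ↔ ∃ α β γ δ : Expo, α ≠ β ∧ α ≠ γ ∧ α ≠ δ ∧ β ≠ γ ∧ β ≠ δ ∧ γ ≠ δ ∧ α + β = γ + δ ∧
      PermutationType.RankOneCoincidences A (Finsupp.single γ 1 + Finsupp.single δ 1)
        (Finsupp.single α 1 + Finsupp.single β 1) := Iff.rfl

/-- Permutation type ⇒ rank one for ANY relation data (the case `k = 0`). -/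
theorem rankOneCoincidences_of_permType (A : Fin m → Finset Expo) (h : PermutationType.PermType A) (ρp ρm : Expo →₀ ℕ) :
    PermutationType.RankOneCoincidences A ρp ρm :=
  PermutationType.rankOneCoincidences_of_permType A h ρp ρm

/-- Per cell-family form of R6: `#S ≤ 2^{2cm}(t+2)^c`. -/
theorem cell_bound_of_rankOneFour (h6 : RankOneFourLaw) :
    ∃ c : ℕ, ∀ (m t : ℕ) (u v : Fin m → MvPolynomial (Fin 2) ℂ),
      (∀ j, coeff 0 (u j) = 0 ∧ (u j).support.card ≤ t) → (∀ j, coeff 0 (v j) = 0 ∧ (v j).support.card ≤ t) →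
      FourTermRankOne (fun j => (u j).support ∪ (v j).support) →
      ∀ (R : Expo → Expo → Prop) (S : Finset Expo), IsCellFamily u v R S → S.card ≤ 2 ^ (c * m) * (t + 2) ^ c := by
  obtain ⟨c, hc⟩ := h6
  refine ⟨2 * c, fun m t u v hu hv hw R S hS => ?_⟩
  have hu0 : ∀ j, coeff 0 (u j) = 0 := fun j => (hu j).1
  have hv0 : ∀ j, coeff 0 (v j) = 0 := fun j => (hv j).1
  have key := hc m u v hu0 hv0 hw S fun l hl => by
    obtain ⟨ξ, hval, htop, -⟩ := hS l hl
    exact ⟨ξ, hval, (stub_logLinearisation m u v hu0 hv0 ξ hval l).2 htop⟩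
  have hT := card_tailSupport_le u v t (fun j => (hu j).2) (fun j => (hv j).2)
  have h1 : (tailSupport u v).card + 2 ≤ 2 ^ m * (t + 2) := by
    have h2m : 2 * m ≤ 2 ^ m := two_mul_le_two_pow m
    have hpos : 1 ≤ 2 ^ m := Nat.one_le_two_pow
    nlinarith
  calc S.card ≤ 2 ^ (c * m) * ((tailSupport u v).card + 2) ^ c := key
    _ ≤ 2 ^ (c * m) * (2 ^ m * (t + 2)) ^ c := Nat.mul_le_mul_left _ (Nat.pow_le_pow_left h1 c)
    _ = 2 ^ (2 * c * m) * (t + 2) ^ c := by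
        rw [mul_pow, ← pow_mul, ← mul_assoc, ← pow_add, show c * m + m * c = 2 * c * m by ring]
    _ ≤ 2 ^ (2 * c * m) * (t + 2) ^ (2 * c) := Nat.mul_le_mul_left _ (Nat.pow_le_pow_right (by omega) (by omega))

/-- **Residual v14** (LAW, 0 provers): the v12 residual MINUS the four-term distinct-letter rank-one configurations.
First inhabitants (val-neg-1 g2 pre-audit §3): shared generic alphabet `#E = t`, ONE planted relation of shape `α = β + γ` or
`2β = α + γ`, at `(m,t) = (5,3834), (6,209), (7,80), (8,50), (9,38), (10,32)` (the v12 frontier with the shape changed); vacuous for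
`m ≤ 4`; a `PermType` family already fails the first hypothesis at `J = {j₀}`. -/
def ResidualLawV14 : Prop :=
  ∃ a b : ℕ, ∀ (m t : ℕ), 2 ≤ t → ∀ (u v : Fin m → MvPolynomial (Fin 2) ℂ),
    (∀ j, coeff 0 (u j) = 0 ∧ (u j).support.card ≤ t) → (∀ j, coeff 0 (v j) = 0 ∧ (v j).support.card ≤ t) →
    (∀ (J : Finset (Fin m)) (j₀ : Fin m), j₀ ∈ J →
      BlockSmall (fun j => (u j).support ∪ (v j).support) J (2 ^ m * (t + 2) ^ 4) →
      ¬ PermutationType.PermType (mergeA (fun j => (u j).support ∪ (v j).support) J j₀)) →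
    (∀ (r : ℕ) (Jc : Fin r → Finset (Fin m)) (ac bc : Fin r → Fin m → Expo),
      ClassCover (fun j => (u j).support ∪ (v j).support) Jc ac bc →
      2 ^ m * (t + 2) ^ 4 < 2 * (m + 1) * (3 * (2 + m + m.choose 2) ^ 2) ^ r) →
    ¬ FourTermRankOne (fun j => (u j).support ∪ (v j).support) →
    ∀ (R : Expo → Expo → Prop) (S : Finset Expo), IsCellFamily u v R S →
      S.card ≤ 2 ^ (a * m) * (t + 2) ^ b

/-- The v14 residual is WEAKER than the v12 one. -/
theorem residualLawV14_of_V12 (h : ResidualLawV12) : ResidualLawV14 := by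
  obtain ⟨a, b, h⟩ := h
  exact ⟨a, b, fun m t ht u v hu hv h10 hcc _ R S hS => h m t ht u v hu hv h10 hcc R S hS⟩

/-! ## v15: RUNG R6b — THREE-TERM RANK ONE (shape `α = β + γ`) — THEOREM (v17: IMPORTED from val-lit-p3 g15's landed Theorems port
`…RankOneThreeLaw{Free,Slice,Shift,Planar,Count,Law}` of the module `Lines/relation_ladder_R6b.lean` @988ccfe3a7f4; 0 sorries) -/

/-- **R6b — the three-term rank-one law, shape `α = β + γ`** (statement text = the R6b module's `R6b.RankOneThreeLaw`,
character-identical; val-lit-p3 g15's Theorems port states it by literal body as `R6b.rankOneThreeLaw_proof`). -/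
def RankOneThreeLaw : Prop :=
  ∃ c : ℕ, ∀ (m : ℕ) (u v : Fin m → MvPolynomial (Fin 2) ℂ), (∀ j, coeff 0 (u j) = 0) → (∀ j, coeff 0 (v j) = 0) →
    (∃ α β γ : Expo, α ≠ β ∧ α ≠ γ ∧ β ≠ γ ∧ α = β + γ ∧
      PermutationType.RankOneCoincidences (fun j => (u j).support ∪ (v j).support)
        (Finsupp.single β 1 + Finsupp.single γ 1) (Finsupp.single α 1)) →
    ∀ S : Finset Expo, (∀ l ∈ S, ∃ ξ : Fin 2 → ℝ, ValidWeight u v ξ ∧ IsStrictTop ξ ↑(tailDiff u v).support l) →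
      S.card ≤ 2 ^ (c * m) * ((tailSupport u v).card + 2) ^ c

/-- **R6b (three-term rank-one law) — THEOREM BY NAME** (v17): val-lit-p3 g15's Theorems port `…RankOneThreeLawLaw ::
PermutationType.R6b.rankOneThreeLaw_proof` (six files `…RankOneThreeLaw{Free,Slice,Shift,Planar,Count,Law}`, port of the module
`Lines/relation_ladder_R6b.lean` @988ccfe3a7f4; statement = the literal body of `RankOneThreeLaw`). -/
theorem stub_rankOneThree : RankOneThreeLaw :=
  PermutationType.R6b.rankOneThreeLaw_proof

/-- A three-term DISTINCT-letter rank-one witness of shape `α = β + γ` for a letter family (the hypothesis of R6b). -/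
def ThreeTermRankOne (A : Fin m → Finset Expo) : Prop :=
  ∃ α β γ : Expo, α ≠ β ∧ α ≠ γ ∧ β ≠ γ ∧ α = β + γ ∧
    PermutationType.RankOneCoincidences A (Finsupp.single β 1 + Finsupp.single γ 1) (Finsupp.single α 1)

/-- Token-identity certificate: the v15 residual's new exclusion clause IS R6b's hypothesis. -/
theorem threeTermRankOne_iff (A : Fin m → Finset Expo) :
    ThreeTermRankOne A ↔ ∃ α β γ : Expo, α ≠ β ∧ α ≠ γ ∧ β ≠ γ ∧ α = β + γ ∧
      PermutationType.RankOneCoincidences A (Finsupp.single β 1 + Finsupp.single γ 1) (Finsupp.single α 1) := Iff.rfl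

/-- **Residual v15** (LAW, 0 provers): the v14 residual MINUS the three-term distinct-letter rank-one configurations of shape
`α = β + γ`.  First inhabitants (val-neg-1 g2 pre-audit §3): shared generic alphabet `#E = t`, ONE planted relation of shape
`2β = α + γ` (R6c) at `(m,t) = (5,3834), (6,209), (7,80), (8,50), (9,38), (10,32)`; vacuous for `m ≤ 4`. -/
def ResidualLawV15 : Prop :=
  ∃ a b : ℕ, ∀ (m t : ℕ), 2 ≤ t → ∀ (u v : Fin m → MvPolynomial (Fin 2) ℂ),
    (∀ j, coeff 0 (u j) = 0 ∧ (u j).support.card ≤ t) → (∀ j, coeff 0 (v j) = 0 ∧ (v j).support.card ≤ t) →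
    (∀ (J : Finset (Fin m)) (j₀ : Fin m), j₀ ∈ J →
      BlockSmall (fun j => (u j).support ∪ (v j).support) J (2 ^ m * (t + 2) ^ 4) →
      ¬ PermutationType.PermType (mergeA (fun j => (u j).support ∪ (v j).support) J j₀)) →
    (∀ (r : ℕ) (Jc : Fin r → Finset (Fin m)) (ac bc : Fin r → Fin m → Expo),
      ClassCover (fun j => (u j).support ∪ (v j).support) Jc ac bc →
      2 ^ m * (t + 2) ^ 4 < 2 * (m + 1) * (3 * (2 + m + m.choose 2) ^ 2) ^ r) →
    ¬ FourTermRankOne (fun j => (u j).support ∪ (v j).support) →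
    ¬ ThreeTermRankOne (fun j => (u j).support ∪ (v j).support) →
    ∀ (R : Expo → Expo → Prop) (S : Finset Expo), IsCellFamily u v R S →
      S.card ≤ 2 ^ (a * m) * (t + 2) ^ b

/-- The v15 residual is WEAKER than the v14 one. -/
theorem residualLawV15_of_V14 (h : ResidualLawV14) : ResidualLawV15 := by
  obtain ⟨a, b, h⟩ := h
  exact ⟨a, b, fun m t ht u v hu hv h10 hcc h4 _ R S hS => h m t ht u v hu hv h10 hcc h4 R S hS⟩

/-! ## RUNG R6c (v16): THREE-TERM RANK ONE, ARITHMETIC-PROGRESSION SHAPE `α + γ = 2β` — TYPED at val-lit-p3 g15's request (bus 10:40:39Z;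
their VERONESE lift `Z ↦ α, W ↦ γ, Y_e ↦ 2e` ⇒ `BinExpSum.binExpPencilCount` by name), THEOREM by name since v17 (p629757
`PermutationType.R6c.rankOneThreeAPLaw_proof`); since v19 also the instance `(2;1,1)` of R7b (full text: git ≤ v19). -/

/-- **R6c — the three-term rank-one law, shape `α + γ = β + β`** (statement dictated by val-lit-p3 g15, bus 10:40:39Z; their port
states it by literal body as `rankOneThreeAPLaw_proof`). -/
def RankOneThreeAPLaw : Prop :=
  ∃ c : ℕ, ∀ (m : ℕ) (u v : Fin m → MvPolynomial (Fin 2) ℂ), (∀ j, coeff 0 (u j) = 0) → (∀ j, coeff 0 (v j) = 0) →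
    (∃ α β γ : Expo, α ≠ β ∧ α ≠ γ ∧ β ≠ γ ∧ α + γ = β + β ∧
      PermutationType.RankOneCoincidences (fun j => (u j).support ∪ (v j).support)
        (Finsupp.single β 2) (Finsupp.single α 1 + Finsupp.single γ 1)) →
    ∀ S : Finset Expo, (∀ l ∈ S, ∃ ξ : Fin 2 → ℝ, ValidWeight u v ξ ∧ IsStrictTop ξ ↑(tailDiff u v).support l) →
      S.card ≤ 2 ^ (c * m) * ((tailSupport u v).card + 2) ^ c

/-- **R6c — THEOREM BY NAME** (v18): val-lit-p3 g15's landed Theorems port `…RankOneAPLawCount ::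
PermutationType.R6c.rankOneThreeAPLaw_proof` (✓ p629757; parts `…RankOneAPLaw{Veronese,Slice,Planar,Weights}`), whose statement is the
literal body of `RankOneThreeAPLaw`. -/
theorem stub_rankOneThreeAP : RankOneThreeAPLaw :=
  PermutationType.R6c.rankOneThreeAPLaw_proof

/-- A three-term DISTINCT-letter rank-one witness of ARITHMETIC-PROGRESSION shape `α + γ = β + β` (the hypothesis of R6c). -/
def ThreeTermAPRankOne (A : Fin m → Finset Expo) : Prop :=
  ∃ α β γ : Expo, α ≠ β ∧ α ≠ γ ∧ β ≠ γ ∧ α + γ = β + β ∧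
    PermutationType.RankOneCoincidences A (Finsupp.single β 2) (Finsupp.single α 1 + Finsupp.single γ 1)

/-- Token identity (for by-name readers): `ThreeTermAPRankOne` is literally the relation hypothesis of `RankOneThreeAPLaw`. -/
theorem threeTermAPRankOne_iff (A : Fin m → Finset Expo) :
    ThreeTermAPRankOne A ↔ ∃ α β γ : Expo, α ≠ β ∧ α ≠ γ ∧ β ≠ γ ∧ α + γ = β + β ∧
      PermutationType.RankOneCoincidences A (Finsupp.single β 2) (Finsupp.single α 1 + Finsupp.single γ 1) :=
  Iff.rfl

/-- **Residual v16** (LAW, 0 provers): the v15 residual MINUS the three-term distinct-letter rank-one configurations of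
arithmetic-progression shape `α + γ = 2β` (R6c).  After R6b + R6c NO rank-one configuration whose (primitive) relation is supported
on ≤ 3 distinct tail letters with coefficient pattern `(1,1,-1,-1)`, `(1,-1,-1)` or `(2,-1,-1)` remains.  First inhabitants to name
(val-neg-1 g2's lane): rank-one families with a relation of another coefficient pattern on 3 letters (e.g. `3β = α + 2γ`,
`2α = 3β` on two letters), relations on ≥ 5 letters, and relation modules of rank ≥ 2. -/
def ResidualLawV16 : Prop :=
  ∃ a b : ℕ, ∀ (m t : ℕ), 2 ≤ t → ∀ (u v : Fin m → MvPolynomial (Fin 2) ℂ),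
    (∀ j, coeff 0 (u j) = 0 ∧ (u j).support.card ≤ t) → (∀ j, coeff 0 (v j) = 0 ∧ (v j).support.card ≤ t) →
    (∀ (J : Finset (Fin m)) (j₀ : Fin m), j₀ ∈ J →
      BlockSmall (fun j => (u j).support ∪ (v j).support) J (2 ^ m * (t + 2) ^ 4) →
      ¬ PermutationType.PermType (mergeA (fun j => (u j).support ∪ (v j).support) J j₀)) →
    (∀ (r : ℕ) (Jc : Fin r → Finset (Fin m)) (ac bc : Fin r → Fin m → Expo),
      ClassCover (fun j => (u j).support ∪ (v j).support) Jc ac bc →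
      2 ^ m * (t + 2) ^ 4 < 2 * (m + 1) * (3 * (2 + m + m.choose 2) ^ 2) ^ r) →
    ¬ FourTermRankOne (fun j => (u j).support ∪ (v j).support) →
    ¬ ThreeTermRankOne (fun j => (u j).support ∪ (v j).support) →
    ¬ ThreeTermAPRankOne (fun j => (u j).support ∪ (v j).support) →
    ∀ (R : Expo → Expo → Prop) (S : Finset Expo), IsCellFamily u v R S →
      S.card ≤ 2 ^ (a * m) * (t + 2) ^ b

/-- The v16 residual is WEAKER than the v15 one. -/
theorem residualLawV16_of_V15 (h : ResidualLawV15) : ResidualLawV16 := by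
  obtain ⟨a, b, h⟩ := h
  exact ⟨a, b, fun m t ht u v hu hv h10 hcc h4 h3 _ R S hS => h m t ht u v hu hv h10 hcc h4 h3 R S hS⟩

/-! ## v18: RUNG R7a (rank one, three-letter shape `α = qβ + rγ`, all `q, r ≥ 1`; v18: PROVED by the inline R7a module, v19: the instance
`p = 1` of R7b), RUNG R6d (HOMOGENEOUS shape `qα + rγ = (q+r)β`, statement = val-lit-p3 g15's posted body verbatim, bus 11:40:05Z; v19: the
instance `p = q + r` of R7b — THEOREM), R6c BY NAME -/

/-- **R7a — the free three-letter rank-one law** (`q = r = 1` is R6b's `RankOneThreeLaw`). -/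
def RankOneThreeFreeLaw : Prop :=
  ∃ c : ℕ, ∀ (m : ℕ) (u v : Fin m → MvPolynomial (Fin 2) ℂ), (∀ j, coeff 0 (u j) = 0) → (∀ j, coeff 0 (v j) = 0) →
    (∃ (α β γ : Expo) (q r : ℕ), 1 ≤ q ∧ 1 ≤ r ∧ α ≠ β ∧ α ≠ γ ∧ β ≠ γ ∧ α = q • β + r • γ ∧
      PermutationType.RankOneCoincidences (fun j => (u j).support ∪ (v j).support)
        (Finsupp.single β q + Finsupp.single γ r) (Finsupp.single α 1)) →
    ∀ S : Finset Expo, (∀ l ∈ S, ∃ ξ : Fin 2 → ℝ, ValidWeight u v ξ ∧ IsStrictTop ξ ↑(tailDiff u v).support l) →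
      S.card ≤ 2 ^ (c * m) * ((tailSupport u v).card + 2) ^ c

/-- **R7a — THEOREM** (no sorry; v19: the instance `p = 1` of R7b, `PermutationType.R7b.visible_bound_free`; v18 proved it from the inline
R7a module `Lines/relation_ladder_R7a.lean` @0a494ab61a34, statement unchanged). -/
theorem stub_rankOneThreeFree : RankOneThreeFreeLaw := by
  obtain ⟨c, hc⟩ := PermutationType.R7b.rankOneThreeGenLaw_proof
  exact ⟨c, PermutationType.R7b.visible_bound_free c hc⟩

/-- A three-letter DISTINCT rank-one witness of FREE shape `α = qβ + rγ`, `q, r ≥ 1` (the hypothesis of R7a). -/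
def ThreeTermFreeRankOne (A : Fin m → Finset Expo) : Prop :=
  ∃ (α β γ : Expo) (q r : ℕ), 1 ≤ q ∧ 1 ≤ r ∧ α ≠ β ∧ α ≠ γ ∧ β ≠ γ ∧ α = q • β + r • γ ∧
    PermutationType.RankOneCoincidences A (Finsupp.single β q + Finsupp.single γ r) (Finsupp.single α 1)

/-- Token identity: `ThreeTermFreeRankOne` is literally the relation hypothesis of `RankOneThreeFreeLaw`. -/
theorem threeTermFreeRankOne_iff (A : Fin m → Finset Expo) :
    ThreeTermFreeRankOne A ↔ ∃ (α β γ : Expo) (q r : ℕ), 1 ≤ q ∧ 1 ≤ r ∧ α ≠ β ∧ α ≠ γ ∧ β ≠ γ ∧ α = q • β + r • γ ∧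
      PermutationType.RankOneCoincidences A (Finsupp.single β q + Finsupp.single γ r) (Finsupp.single α 1) :=
  Iff.rfl

/-- R6b's witness is the case `q = r = 1` of R7a's. -/
theorem threeTermFreeRankOne_of_threeTerm (A : Fin m → Finset Expo) (h : ThreeTermRankOne A) : ThreeTermFreeRankOne A := by
  obtain ⟨α, β, γ, hab, hac, hbc, hrel, hR⟩ := h
  exact ⟨α, β, γ, 1, 1, le_refl 1, le_refl 1, hab, hac, hbc, by rw [one_nsmul, one_nsmul]; exact hrel, hR⟩

/-- **R6d — the HOMOGENEOUS three-letter rank-one law** `qα + rγ = (q+r)β` (statement = val-lit-p3 g15's posted body VERBATIM, val-width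
bus 11:40:05Z: lift `α ↦ Z^{q+r}`, `β ↦ Z^q W^r`, `γ ↦ W^{q+r}`, push-forward `Y_e ↦ (q+r)e`; their tool; `q + r ≤ m` automatic for a
non-vacuous relation).  R6c (`RankOneThreeAPLaw`) is the case `q = r = 1`. -/
def RankOneHomThreeLaw : Prop :=
  ∃ c : ℕ, ∀ (m : ℕ) (u v : Fin m → MvPolynomial (Fin 2) ℂ), (∀ j, coeff 0 (u j) = 0) → (∀ j, coeff 0 (v j) = 0) →
    (∃ α β γ : Expo, ∃ q r : ℕ, α ≠ β ∧ α ≠ γ ∧ β ≠ γ ∧ 1 ≤ q ∧ 1 ≤ r ∧ q • α + r • γ = (q + r) • β ∧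
      PermutationType.RankOneCoincidences (fun j => (u j).support ∪ (v j).support)
        (Finsupp.single β (q + r)) (Finsupp.single α q + Finsupp.single γ r)) →
    ∀ S : Finset Expo, (∀ l ∈ S, ∃ ξ : Fin 2 → ℝ, ValidWeight u v ξ ∧ IsStrictTop ξ ↑(tailDiff u v).support l) →
      S.card ≤ 2 ^ (c * m) * ((tailSupport u v).card + 2) ^ c

/-- **R6d — THEOREM** (v19, no sorry): the instance `p = q + r` of R7b with the roles `α ↦ β, β ↦ α` (`PermutationType.R7b.visible_bound_hom`,
`R7b.rankOne_symm`); statement = val-lit-p3 g15's posted body verbatim (a Theorems port by them stays welcome as the by-name citation). -/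
theorem stub_rankOneHomThree : RankOneHomThreeLaw := by
  obtain ⟨c, hc⟩ := PermutationType.R7b.rankOneThreeGenLaw_proof
  exact ⟨c, PermutationType.R7b.visible_bound_hom c hc⟩

/-- A three-letter DISTINCT rank-one witness of HOMOGENEOUS shape `qα + rγ = (q+r)β` (the hypothesis of R6d). -/
def ThreeTermHomRankOne (A : Fin m → Finset Expo) : Prop :=
  ∃ α β γ : Expo, ∃ q r : ℕ, α ≠ β ∧ α ≠ γ ∧ β ≠ γ ∧ 1 ≤ q ∧ 1 ≤ r ∧ q • α + r • γ = (q + r) • β ∧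
    PermutationType.RankOneCoincidences A (Finsupp.single β (q + r)) (Finsupp.single α q + Finsupp.single γ r)

/-- Token identity: `ThreeTermHomRankOne` is literally the relation hypothesis of `RankOneHomThreeLaw`. -/
theorem threeTermHomRankOne_iff (A : Fin m → Finset Expo) :
    ThreeTermHomRankOne A ↔ ∃ α β γ : Expo, ∃ q r : ℕ, α ≠ β ∧ α ≠ γ ∧ β ≠ γ ∧ 1 ≤ q ∧ 1 ≤ r ∧ q • α + r • γ = (q + r) • β ∧
      PermutationType.RankOneCoincidences A (Finsupp.single β (q + r)) (Finsupp.single α q + Finsupp.single γ r) :=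
  Iff.rfl

/-- R6c's witness is the case `q = r = 1` of R6d's. -/
theorem threeTermHomRankOne_of_AP (A : Fin m → Finset Expo) (h : ThreeTermAPRankOne A) : ThreeTermHomRankOne A := by
  obtain ⟨α, β, γ, hab, hac, hbc, hrel, hR⟩ := h
  refine ⟨α, β, γ, 1, 1, hab, hac, hbc, le_refl 1, le_refl 1, ?_, ?_⟩
  · rw [one_nsmul, one_nsmul, hrel, ← two_nsmul]
  · exact hR

/-- **Residual v18** (LAW, 0 provers): the v16 residual MINUS the rank-one configurations with a three-letter relation of FREE shape
`α = qβ + rγ` (R7a, PROVED) and MINUS those of HOMOGENEOUS shape `qα + rγ = (q+r)β` (R6d, typed).  After v18 the rank-one three-letter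
relations `pα = qβ + rγ` still inside the residual are exactly the INHOMOGENEOUS ones with `p ≥ 2`, `p ≠ q + r` (R7b's target); beyond:
two-letter torsion-free shapes are impossible (`pα = qβ`, `p ≠ q` forces a common direction — still a genuine relation, e.g. `2α = 3β`,
NOT removed), relations on ≥ 5 letters, relation modules of rank ≥ 2. -/
def ResidualLawV18 : Prop :=
  ∃ a b : ℕ, ∀ (m t : ℕ), 2 ≤ t → ∀ (u v : Fin m → MvPolynomial (Fin 2) ℂ),
    (∀ j, coeff 0 (u j) = 0 ∧ (u j).support.card ≤ t) → (∀ j, coeff 0 (v j) = 0 ∧ (v j).support.card ≤ t) →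
    (∀ (J : Finset (Fin m)) (j₀ : Fin m), j₀ ∈ J →
      BlockSmall (fun j => (u j).support ∪ (v j).support) J (2 ^ m * (t + 2) ^ 4) →
      ¬ PermutationType.PermType (mergeA (fun j => (u j).support ∪ (v j).support) J j₀)) →
    (∀ (r : ℕ) (Jc : Fin r → Finset (Fin m)) (ac bc : Fin r → Fin m → Expo),
      ClassCover (fun j => (u j).support ∪ (v j).support) Jc ac bc →
      2 ^ m * (t + 2) ^ 4 < 2 * (m + 1) * (3 * (2 + m + m.choose 2) ^ 2) ^ r) →
    ¬ FourTermRankOne (fun j => (u j).support ∪ (v j).support) →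
    ¬ ThreeTermRankOne (fun j => (u j).support ∪ (v j).support) →
    ¬ ThreeTermAPRankOne (fun j => (u j).support ∪ (v j).support) →
    ¬ ThreeTermFreeRankOne (fun j => (u j).support ∪ (v j).support) →
    ¬ ThreeTermHomRankOne (fun j => (u j).support ∪ (v j).support) →
    ∀ (R : Expo → Expo → Prop) (S : Finset Expo), IsCellFamily u v R S →
      S.card ≤ 2 ^ (a * m) * (t + 2) ^ b

/-- The v18 residual is WEAKER than the v16 one. -/
theorem residualLawV18_of_V16 (h : ResidualLawV16) : ResidualLawV18 := by
  obtain ⟨a, b, h⟩ := h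
  exact ⟨a, b, fun m t ht u v hu hv h10 hcc h4 h3 h3ap _ _ R S hS => h m t ht u v hu hv h10 hcc h4 h3 h3ap R S hS⟩

/-! ## v19: RUNG R7b (PROVED — inline copy above): rank one, GENERAL three-letter relation `pα = qβ + rγ`, ALL `p, q, r ≥ 1`; R7a and R6d
are instances; the residual loses EVERY rank-one configuration whose relation lives on three distinct tail letters -/

/-- **R7b — the general three-letter rank-one law** (all coefficient patterns `(p; q, r)`; `(1;q,r)` R7a, `(1;1,1)` R6b, `(2;1,1)` R6c,
`(q+r;q,r)` R6d). -/
def RankOneThreeGenLaw : Prop :=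
  ∃ c : ℕ, ∀ (m : ℕ) (u v : Fin m → MvPolynomial (Fin 2) ℂ), (∀ j, coeff 0 (u j) = 0) → (∀ j, coeff 0 (v j) = 0) →
    (∃ (α β γ : Expo) (p q r : ℕ), 1 ≤ p ∧ 1 ≤ q ∧ 1 ≤ r ∧ α ≠ β ∧ α ≠ γ ∧ β ≠ γ ∧ p • α = q • β + r • γ ∧
      PermutationType.RankOneCoincidences (fun j => (u j).support ∪ (v j).support)
        (Finsupp.single β q + Finsupp.single γ r) (Finsupp.single α p)) →
    ∀ S : Finset Expo, (∀ l ∈ S, ∃ ξ : Fin 2 → ℝ, ValidWeight u v ξ ∧ IsStrictTop ξ ↑(tailDiff u v).support l) →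
      S.card ≤ 2 ^ (c * m) * ((tailSupport u v).card + 2) ^ c

/-- **R7b — THEOREM** (no sorry): `PermutationType.R7b.rankOneThreeGenLaw_proof` from the inline copy of `Lines/relation_ladder_R7b.lean`
@401510f57069 (becomes an `import` when a Theorems port lands; no statement change). -/
theorem stub_rankOneThreeGen : RankOneThreeGenLaw :=
  PermutationType.R7b.rankOneThreeGenLaw_proof

/-- A three-letter DISTINCT rank-one witness of GENERAL shape `pα = qβ + rγ`, `p, q, r ≥ 1` (the hypothesis of R7b). -/
def ThreeTermGenRankOne (A : Fin m → Finset Expo) : Prop :=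
  ∃ (α β γ : Expo) (p q r : ℕ), 1 ≤ p ∧ 1 ≤ q ∧ 1 ≤ r ∧ α ≠ β ∧ α ≠ γ ∧ β ≠ γ ∧ p • α = q • β + r • γ ∧
    PermutationType.RankOneCoincidences A (Finsupp.single β q + Finsupp.single γ r) (Finsupp.single α p)

/-- Token identity: `ThreeTermGenRankOne` is literally the relation hypothesis of `RankOneThreeGenLaw`. -/
theorem threeTermGenRankOne_iff (A : Fin m → Finset Expo) :
    ThreeTermGenRankOne A ↔ ∃ (α β γ : Expo) (p q r : ℕ), 1 ≤ p ∧ 1 ≤ q ∧ 1 ≤ r ∧ α ≠ β ∧ α ≠ γ ∧ β ≠ γ ∧ p • α = q • β + r • γ ∧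
      PermutationType.RankOneCoincidences A (Finsupp.single β q + Finsupp.single γ r) (Finsupp.single α p) :=
  Iff.rfl

/-- R7a's witness is the case `p = 1` of R7b's. -/
theorem threeTermGenRankOne_of_free (A : Fin m → Finset Expo) (h : ThreeTermFreeRankOne A) : ThreeTermGenRankOne A := by
  obtain ⟨α, β, γ, q, r, hq, hr, hab, hac, hbc, hrel, hR⟩ := h
  exact ⟨α, β, γ, 1, q, r, le_refl 1, hq, hr, hab, hac, hbc, by rw [one_nsmul]; exact hrel, hR⟩

/-- R6d's witness is the case `p = q + r` of R7b's (roles `α ↦ β, β ↦ α`, sides of the coincidence swapped). -/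
theorem threeTermGenRankOne_of_hom (A : Fin m → Finset Expo) (h : ThreeTermHomRankOne A) : ThreeTermGenRankOne A := by
  obtain ⟨α, β, γ, q, r, hab, hac, hbc, hq, hr, hrel, hR⟩ := h
  exact ⟨β, α, γ, q + r, q, r, by omega, hq, hr, Ne.symm hab, hbc, hac, hrel.symm, PermutationType.R6c.rankOneCoincidences_symm _ _ _ hR⟩

/-- R7b in CELL form (log-linearisation R2 + `#T ≤ 2mt`). -/
theorem cell_bound_of_rankOneThreeGen (h7 : RankOneThreeGenLaw) :
    ∃ c : ℕ, ∀ (m t : ℕ) (u v : Fin m → MvPolynomial (Fin 2) ℂ),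
      (∀ j, coeff 0 (u j) = 0 ∧ (u j).support.card ≤ t) → (∀ j, coeff 0 (v j) = 0 ∧ (v j).support.card ≤ t) →
      ThreeTermGenRankOne (fun j => (u j).support ∪ (v j).support) →
      ∀ (R : Expo → Expo → Prop) (S : Finset Expo), IsCellFamily u v R S → S.card ≤ 2 ^ (c * m) * (t + 2) ^ c := by
  obtain ⟨c, hc⟩ := h7
  refine ⟨2 * c, fun m t u v hu hv hw R S hS => ?_⟩
  have hu0 : ∀ j, coeff 0 (u j) = 0 := fun j => (hu j).1
  have hv0 : ∀ j, coeff 0 (v j) = 0 := fun j => (hv j).1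
  have key := hc m u v hu0 hv0 hw S fun l hl => by
    obtain ⟨ξ, hval, htop, -⟩ := hS l hl
    exact ⟨ξ, hval, (stub_logLinearisation m u v hu0 hv0 ξ hval l).2 htop⟩
  have hT := card_tailSupport_le u v t (fun j => (hu j).2) (fun j => (hv j).2)
  have h1 : (tailSupport u v).card + 2 ≤ 2 ^ m * (t + 2) := by
    have h2m : 2 * m ≤ 2 ^ m := two_mul_le_two_pow m
    have hpos : 1 ≤ 2 ^ m := Nat.one_le_two_pow
    nlinarith
  calc S.card ≤ 2 ^ (c * m) * ((tailSupport u v).card + 2) ^ c := key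
    _ ≤ 2 ^ (c * m) * (2 ^ m * (t + 2)) ^ c := Nat.mul_le_mul_left _ (Nat.pow_le_pow_left h1 c)
    _ = 2 ^ (2 * c * m) * (t + 2) ^ c := by
        rw [mul_pow, ← pow_mul, ← mul_assoc, ← pow_add, show c * m + m * c = 2 * c * m by ring]
    _ ≤ 2 ^ (2 * c * m) * (t + 2) ^ (2 * c) := Nat.mul_le_mul_left _ (Nat.pow_le_pow_right (by omega) (by omega))

/-- **Residual v19** (LAW, 0 provers): the v18 residual MINUS every rank-one configuration with a relation `pα = qβ + rγ` on three
distinct tail letters (R7b, PROVED; the earlier three-letter negations are implied by `¬ ThreeTermGenRankOne` and kept only so that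
`residualLawV19_of_V18` is a plain weakening).  What remains: no lattice-small block contraction to permutation type (R5), no cheap
relation-class cover (R1_r), no four-term rank one `α + β = γ + δ` (R6), no three-letter rank one (R7b) — i.e. rank one on two letters
with torsion (`pα = qβ`, `p ≠ q`), on four letters with general coefficients, on ≥ 5 letters, or a relation module of rank ≥ 2. -/
def ResidualLawV19 : Prop :=
  ∃ a b : ℕ, ∀ (m t : ℕ), 2 ≤ t → ∀ (u v : Fin m → MvPolynomial (Fin 2) ℂ),
    (∀ j, coeff 0 (u j) = 0 ∧ (u j).support.card ≤ t) → (∀ j, coeff 0 (v j) = 0 ∧ (v j).support.card ≤ t) →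
    (∀ (J : Finset (Fin m)) (j₀ : Fin m), j₀ ∈ J →
      BlockSmall (fun j => (u j).support ∪ (v j).support) J (2 ^ m * (t + 2) ^ 4) →
      ¬ PermutationType.PermType (mergeA (fun j => (u j).support ∪ (v j).support) J j₀)) →
    (∀ (r : ℕ) (Jc : Fin r → Finset (Fin m)) (ac bc : Fin r → Fin m → Expo),
      ClassCover (fun j => (u j).support ∪ (v j).support) Jc ac bc →
      2 ^ m * (t + 2) ^ 4 < 2 * (m + 1) * (3 * (2 + m + m.choose 2) ^ 2) ^ r) →
    ¬ FourTermRankOne (fun j => (u j).support ∪ (v j).support) →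
    ¬ ThreeTermRankOne (fun j => (u j).support ∪ (v j).support) →
    ¬ ThreeTermAPRankOne (fun j => (u j).support ∪ (v j).support) →
    ¬ ThreeTermFreeRankOne (fun j => (u j).support ∪ (v j).support) →
    ¬ ThreeTermHomRankOne (fun j => (u j).support ∪ (v j).support) →
    ¬ ThreeTermGenRankOne (fun j => (u j).support ∪ (v j).support) →
    ∀ (R : Expo → Expo → Prop) (S : Finset Expo), IsCellFamily u v R S →
      S.card ≤ 2 ^ (a * m) * (t + 2) ^ b

/-- The v19 residual is WEAKER than the v18 one. -/
theorem residualLawV19_of_V18 (h : ResidualLawV18) : ResidualLawV19 := by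
  obtain ⟨a, b, h⟩ := h
  exact ⟨a, b, fun m t ht u v hu hv h10 hcc h4 h3 h3ap h3f h3h _ R S hS => h m t ht u v hu hv h10 hcc h4 h3 h3ap h3f h3h R S hS⟩

/-- Conversely the v19 hypotheses already give the v18 ones through R7b's witness embeddings: under `¬ ThreeTermGenRankOne` the FREE and
HOMOGENEOUS negations are automatic (bookkeeping lemma; shows the v19 residual is V16's hypotheses ∧ `¬ FourTerm…` ∧ `¬ ThreeTermGen…`). -/
theorem threeTerm_negations_of_gen (A : Fin m → Finset Expo) (h : ¬ ThreeTermGenRankOne A) :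
    ¬ ThreeTermFreeRankOne A ∧ ¬ ThreeTermHomRankOne A :=
  ⟨fun w => h (threeTermGenRankOne_of_free A w), fun w => h (threeTermGenRankOne_of_hom A w)⟩

/-! ## v20: RUNG R7c (PROVED — inline module REV 2 above): rank one on TWO letters with torsion `pα = qβ`, `α ≠ β`, `p, q ≥ 1` -/

/-- **R7c — the two-letter torsion rank-one law.** -/
def RankOneTwoLaw : Prop :=
  ∃ c : ℕ, ∀ (m : ℕ) (u v : Fin m → MvPolynomial (Fin 2) ℂ), (∀ j, coeff 0 (u j) = 0) → (∀ j, coeff 0 (v j) = 0) →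
    (∃ (α β : Expo) (p q : ℕ), 1 ≤ p ∧ 1 ≤ q ∧ α ≠ β ∧ p • α = q • β ∧
      PermutationType.RankOneCoincidences (fun j => (u j).support ∪ (v j).support)
        (Finsupp.single β q) (Finsupp.single α p)) →
    ∀ S : Finset Expo, (∀ l ∈ S, ∃ ξ : Fin 2 → ℝ, ValidWeight u v ξ ∧ IsStrictTop ξ ↑(tailDiff u v).support l) →
      S.card ≤ 2 ^ (c * m) * ((tailSupport u v).card + 2) ^ c

/-- **R7c — THEOREM** (no sorry): `PermutationType.R7b.rankOneTwoLaw_proof` (the `r = 0` instance of the R7b engine with an idle third letter). -/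
theorem stub_rankOneTwo : RankOneTwoLaw :=
  PermutationType.R7b.rankOneTwoLaw_proof

/-- A two-letter rank-one witness with torsion `pα = qβ` (the hypothesis of R7c). -/
def TwoTermRankOne (A : Fin m → Finset Expo) : Prop :=
  ∃ (α β : Expo) (p q : ℕ), 1 ≤ p ∧ 1 ≤ q ∧ α ≠ β ∧ p • α = q • β ∧
    PermutationType.RankOneCoincidences A (Finsupp.single β q) (Finsupp.single α p)

/-- Token identity: `TwoTermRankOne` is literally the relation hypothesis of `RankOneTwoLaw`. -/
theorem twoTermRankOne_iff (A : Fin m → Finset Expo) :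
    TwoTermRankOne A ↔ ∃ (α β : Expo) (p q : ℕ), 1 ≤ p ∧ 1 ≤ q ∧ α ≠ β ∧ p • α = q • β ∧
      PermutationType.RankOneCoincidences A (Finsupp.single β q) (Finsupp.single α p) :=
  Iff.rfl

/-- R7c in CELL form (log-linearisation R2 + `#T ≤ 2mt`). -/
theorem cell_bound_of_rankOneTwo (h7 : RankOneTwoLaw) :
    ∃ c : ℕ, ∀ (m t : ℕ) (u v : Fin m → MvPolynomial (Fin 2) ℂ),
      (∀ j, coeff 0 (u j) = 0 ∧ (u j).support.card ≤ t) → (∀ j, coeff 0 (v j) = 0 ∧ (v j).support.card ≤ t) →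
      TwoTermRankOne (fun j => (u j).support ∪ (v j).support) →
      ∀ (R : Expo → Expo → Prop) (S : Finset Expo), IsCellFamily u v R S → S.card ≤ 2 ^ (c * m) * (t + 2) ^ c := by
  obtain ⟨c, hc⟩ := h7
  refine ⟨2 * c, fun m t u v hu hv hw R S hS => ?_⟩
  have hu0 : ∀ j, coeff 0 (u j) = 0 := fun j => (hu j).1
  have hv0 : ∀ j, coeff 0 (v j) = 0 := fun j => (hv j).1
  have key := hc m u v hu0 hv0 hw S fun l hl => by
    obtain ⟨ξ, hval, htop, -⟩ := hS l hl
    exact ⟨ξ, hval, (stub_logLinearisation m u v hu0 hv0 ξ hval l).2 htop⟩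
  have hT := card_tailSupport_le u v t (fun j => (hu j).2) (fun j => (hv j).2)
  have h1 : (tailSupport u v).card + 2 ≤ 2 ^ m * (t + 2) := by
    have h2m : 2 * m ≤ 2 ^ m := two_mul_le_two_pow m
    have hpos : 1 ≤ 2 ^ m := Nat.one_le_two_pow
    nlinarith
  calc S.card ≤ 2 ^ (c * m) * ((tailSupport u v).card + 2) ^ c := key
    _ ≤ 2 ^ (c * m) * (2 ^ m * (t + 2)) ^ c := Nat.mul_le_mul_left _ (Nat.pow_le_pow_left h1 c)
    _ = 2 ^ (2 * c * m) * (t + 2) ^ c := by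
        rw [mul_pow, ← pow_mul, ← mul_assoc, ← pow_add, show c * m + m * c = 2 * c * m by ring]
    _ ≤ 2 ^ (2 * c * m) * (t + 2) ^ (2 * c) := Nat.mul_le_mul_left _ (Nat.pow_le_pow_right (by omega) (by omega))

/-! ## v21: RUNG R9 (PROVED — `Theorems/NewtonUnitEquationsTwoProductsRankOneSchemaLaw{Lift,Fibres,Slice,SliceExc,Planar,Weights,Count,Law}`,
val-lit-p3 g16): the RANK-ONE SCHEMA law — ONE datum `(ρ⁺, ρ⁻)` of ANY shape -/

/-- **R9 — the rank-one schema law** (typed target `HOME/lmr/staged/p3g16-R9/sketch_R9.lean :: R9.RankOneSchemaLaw`, character-identical):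
if ALL additive coincidences of the letter family are multiples of ONE datum `(ρ⁺, ρ⁻)` — no side condition on the datum — then the
global visible bound holds.  R3♯ / R6 / R6b / R6c / R7a / R7b / R7c / R8 are instances. -/
def RankOneSchemaLaw : Prop :=
  ∃ c : ℕ, ∀ (m : ℕ) (u v : Fin m → MvPolynomial (Fin 2) ℂ), (∀ j, coeff 0 (u j) = 0) → (∀ j, coeff 0 (v j) = 0) →
    (∃ ρp ρm : Expo →₀ ℕ, PermutationType.RankOneCoincidences (fun j => (u j).support ∪ (v j).support) ρp ρm) →
    ∀ S : Finset Expo, (∀ l ∈ S, ∃ ξ : Fin 2 → ℝ, ValidWeight u v ξ ∧ IsStrictTop ξ ↑(tailDiff u v).support l) →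
      S.card ≤ 2 ^ (c * m) * ((tailSupport u v).card + 2) ^ c

/-- **R9 — THEOREM** (no sorry): `PermutationType.R9.rankOneSchemaLaw_proof` (transportation lift `Y_{α_i} ↦ ∏_j Z_{ij}^{q_j}`,
`Y_{β_j} ↦ ∏_i Z_{ij}^{p_i}`, product-plan push-forward and weights; `c = 1416`). -/
theorem stub_rankOneSchema : RankOneSchemaLaw :=
  PermutationType.R9.rankOneSchemaLaw_proof

/-- The additive coincidences of the family have RANK ≤ 1: some datum serves them all (the hypothesis of R9). -/
def HasDatum (A : Fin m → Finset Expo) : Prop :=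
  ∃ ρp ρm : Expo →₀ ℕ, PermutationType.RankOneCoincidences A ρp ρm

/-- Permutation type has a datum. -/
theorem hasDatum_of_permType (A : Fin m → Finset Expo) (h : PermutationType.PermType A) : HasDatum A :=
  ⟨0, 0, PermutationType.rankOneCoincidences_of_permType A h 0 0⟩

/-- The R6 witness has a datum. -/
theorem hasDatum_of_fourTerm (A : Fin m → Finset Expo) (h : FourTermRankOne A) : HasDatum A := by
  obtain ⟨α, β, γ, δ, -, -, -, -, -, -, -, hR⟩ := h
  exact ⟨_, _, hR⟩

/-- The R7b witness has a datum. -/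
theorem hasDatum_of_threeTermGen (A : Fin m → Finset Expo) (h : ThreeTermGenRankOne A) : HasDatum A := by
  obtain ⟨α, β, γ, p, q, r, -, -, -, -, -, -, -, hR⟩ := h
  exact ⟨_, _, hR⟩

/-- The R7c witness has a datum. -/
theorem hasDatum_of_twoTerm (A : Fin m → Finset Expo) (h : TwoTermRankOne A) : HasDatum A := by
  obtain ⟨α, β, p, q, -, -, -, -, hR⟩ := h
  exact ⟨_, _, hR⟩

/-- R9 in CELL form (log-linearisation R2 + `#T ≤ 2mt`). -/
theorem cell_bound_of_rankOneSchema (h9 : RankOneSchemaLaw) :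
    ∃ c : ℕ, ∀ (m t : ℕ) (u v : Fin m → MvPolynomial (Fin 2) ℂ),
      (∀ j, coeff 0 (u j) = 0 ∧ (u j).support.card ≤ t) → (∀ j, coeff 0 (v j) = 0 ∧ (v j).support.card ≤ t) →
      HasDatum (fun j => (u j).support ∪ (v j).support) →
      ∀ (R : Expo → Expo → Prop) (S : Finset Expo), IsCellFamily u v R S → S.card ≤ 2 ^ (c * m) * (t + 2) ^ c := by
  obtain ⟨c, hc⟩ := h9
  refine ⟨2 * c, fun m t u v hu hv hw R S hS => ?_⟩
  have hu0 : ∀ j, coeff 0 (u j) = 0 := fun j => (hu j).1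
  have hv0 : ∀ j, coeff 0 (v j) = 0 := fun j => (hv j).1
  have key := hc m u v hu0 hv0 hw S fun l hl => by
    obtain ⟨ξ, hval, htop, -⟩ := hS l hl
    exact ⟨ξ, hval, (stub_logLinearisation m u v hu0 hv0 ξ hval l).2 htop⟩
  have hT := card_tailSupport_le u v t (fun j => (hu j).2) (fun j => (hv j).2)
  have h1 : (tailSupport u v).card + 2 ≤ 2 ^ m * (t + 2) := by
    have h2m : 2 * m ≤ 2 ^ m := two_mul_le_two_pow m
    have hpos : 1 ≤ 2 ^ m := Nat.one_le_two_pow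
    nlinarith
  calc S.card ≤ 2 ^ (c * m) * ((tailSupport u v).card + 2) ^ c := key
    _ ≤ 2 ^ (c * m) * (2 ^ m * (t + 2)) ^ c := Nat.mul_le_mul_left _ (Nat.pow_le_pow_left h1 c)
    _ = 2 ^ (2 * c * m) * (t + 2) ^ c := by
        rw [mul_pow, ← pow_mul, ← mul_assoc, ← pow_add, show c * m + m * c = 2 * c * m by ring]
    _ ≤ 2 ^ (2 * c * m) * (t + 2) ^ (2 * c) := Nat.mul_le_mul_left _ (Nat.pow_le_pow_right (by omega) (by omega))

/-- **Residual v20** (LAW, 0 provers): the v19 residual MINUS the rank-one configurations with a two-letter torsion relation `pα = qβ`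
(R7c, PROVED).  What remains: no lattice-small block contraction to permutation type (R5), no cheap relation-class cover (R1_r), and the
coincidences are NOT rank one with relation supported on ≤ 3 tail letters nor four-term `α + β = γ + δ` — i.e. rank one on four letters with
general coefficients, on ≥ 5 letters, or a relation module of rank ≥ 2. -/
def ResidualLawV20 : Prop :=
  ∃ a b : ℕ, ∀ (m t : ℕ), 2 ≤ t → ∀ (u v : Fin m → MvPolynomial (Fin 2) ℂ),
    (∀ j, coeff 0 (u j) = 0 ∧ (u j).support.card ≤ t) → (∀ j, coeff 0 (v j) = 0 ∧ (v j).support.card ≤ t) →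
    (∀ (J : Finset (Fin m)) (j₀ : Fin m), j₀ ∈ J →
      BlockSmall (fun j => (u j).support ∪ (v j).support) J (2 ^ m * (t + 2) ^ 4) →
      ¬ PermutationType.PermType (mergeA (fun j => (u j).support ∪ (v j).support) J j₀)) →
    (∀ (r : ℕ) (Jc : Fin r → Finset (Fin m)) (ac bc : Fin r → Fin m → Expo),
      ClassCover (fun j => (u j).support ∪ (v j).support) Jc ac bc →
      2 ^ m * (t + 2) ^ 4 < 2 * (m + 1) * (3 * (2 + m + m.choose 2) ^ 2) ^ r) →
    ¬ FourTermRankOne (fun j => (u j).support ∪ (v j).support) →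
    ¬ ThreeTermRankOne (fun j => (u j).support ∪ (v j).support) →
    ¬ ThreeTermAPRankOne (fun j => (u j).support ∪ (v j).support) →
    ¬ ThreeTermFreeRankOne (fun j => (u j).support ∪ (v j).support) →
    ¬ ThreeTermHomRankOne (fun j => (u j).support ∪ (v j).support) →
    ¬ ThreeTermGenRankOne (fun j => (u j).support ∪ (v j).support) →
    ¬ TwoTermRankOne (fun j => (u j).support ∪ (v j).support) →
    ∀ (R : Expo → Expo → Prop) (S : Finset Expo), IsCellFamily u v R S →
      S.card ≤ 2 ^ (a * m) * (t + 2) ^ b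

/-- The v20 residual is WEAKER than the v19 one. -/
theorem residualLawV20_of_V19 (h : ResidualLawV19) : ResidualLawV20 := by
  obtain ⟨a, b, h⟩ := h
  exact ⟨a, b, fun m t ht u v hu hv h10 hcc h4 h3 h3ap h3f h3h h3g _ R S hS =>
    h m t ht u v hu hv h10 hcc h4 h3 h3ap h3f h3h h3g R S hS⟩

/-- **Residual v21** (LAW, 0 provers): the v20 residual MINUS every rank-one configuration (R9, PROVED).  What remains: no lattice-small
block contraction to permutation type (R5), no cheap relation-class cover (R1_r), and the additive coincidences admit NO datum at all —
i.e. the coincidence module has RANK ≥ 2 (first inhabitants: val-neg-1 g4's two planted unit pairs, `Theorems/TwoProducts/Negative/RankTwoEscapes`). -/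
def ResidualLawV21 : Prop :=
  ∃ a b : ℕ, ∀ (m t : ℕ), 2 ≤ t → ∀ (u v : Fin m → MvPolynomial (Fin 2) ℂ),
    (∀ j, coeff 0 (u j) = 0 ∧ (u j).support.card ≤ t) → (∀ j, coeff 0 (v j) = 0 ∧ (v j).support.card ≤ t) →
    (∀ (J : Finset (Fin m)) (j₀ : Fin m), j₀ ∈ J →
      BlockSmall (fun j => (u j).support ∪ (v j).support) J (2 ^ m * (t + 2) ^ 4) →
      ¬ PermutationType.PermType (mergeA (fun j => (u j).support ∪ (v j).support) J j₀)) →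
    (∀ (r : ℕ) (Jc : Fin r → Finset (Fin m)) (ac bc : Fin r → Fin m → Expo),
      ClassCover (fun j => (u j).support ∪ (v j).support) Jc ac bc →
      2 ^ m * (t + 2) ^ 4 < 2 * (m + 1) * (3 * (2 + m + m.choose 2) ^ 2) ^ r) →
    ¬ HasDatum (fun j => (u j).support ∪ (v j).support) →
    ∀ (R : Expo → Expo → Prop) (S : Finset Expo), IsCellFamily u v R S →
      S.card ≤ 2 ^ (a * m) * (t + 2) ^ b

/-- The v21 residual is WEAKER than the v20 one (a family with no datum has none of the seven rank-one witnesses). -/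
theorem residualLawV21_of_V20 (h : ResidualLawV20) : ResidualLawV21 := by
  obtain ⟨a, b, h⟩ := h
  refine ⟨a, b, fun m t ht u v hu hv h10 hcc hD R S hS => h m t ht u v hu hv h10 hcc ?_ ?_ ?_ ?_ ?_ ?_ ?_ R S hS⟩
  · exact fun w => hD (hasDatum_of_fourTerm _ w)
  · exact fun w => hD (hasDatum_of_threeTermGen _ (threeTermGenRankOne_of_free _ (threeTermFreeRankOne_of_threeTerm _ w)))
  · exact fun w => hD (hasDatum_of_threeTermGen _ (threeTermGenRankOne_of_hom _ (threeTermHomRankOne_of_AP _ w)))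
  · exact fun w => hD (hasDatum_of_threeTermGen _ (threeTermGenRankOne_of_free _ w))
  · exact fun w => hD (hasDatum_of_threeTermGen _ (threeTermGenRankOne_of_hom _ w))
  · exact fun w => hD (hasDatum_of_threeTermGen _ w)
  · exact fun w => hD (hasDatum_of_twoTerm _ w)

/-! ## v22: RUNG R10 `ConfinedTameLaw C` (val-idea-37 `positive-circuit-chart`; PROVED for all `C` by val-lit-p3 g16) and the v22 residual -/

/-- **RUNG R10 (THEOREM, by name from Theorems, FOR ALL `C`)**: letter-confined (`#L ≤ C·m`) and tame (fibre spread `≤ (m+2)^C`) relation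
lattices obey the per-cell law, any coincidence rank, no datum (`R10.confinedTameLaw_holds`: positive-circuit chart + chart lift + finset fibres +
mass-regrouped slice functions of shift rank `2m(Δ+1)` + `ShiftRank.pencilCount`).  R275 P3 scope: a PROPER positive sub-case of the residual. -/
theorem stub_confinedTame : ∀ C : ℕ, PermutationType.R10Defs.ConfinedTameLaw C :=
  PermutationType.R10.confinedTameLaw_holds

/-- **Residual v22** (LAW, 0 provers): the v21 residual MINUS, for a `C` of the prover's choice, every configuration whose realised relation
lattice is letter-confined to `≤ C·m` letters AND tame (fibre spread `≤ (m+2)^C`) (R10, PROVED for every `C`).  What remains: coincidence rank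
`≥ 2` (no datum), no R5 contraction, no cheap R1_r cover, and — for the chosen `C` — relation support `> C·m` letters OR a saturated fibre of mass
`> (m+2)^C` (carry/digit towers).  HONEST LABEL: for each fixed `C` this is EQUIVALENT to `PlanarCellBound`
(`Negative/TowerPaddingResidual.residualNotTame_iff_planarCellBound`). -/
def ResidualLawV22 : Prop :=
  ∃ C a b : ℕ, ∀ (m t : ℕ), 2 ≤ t → ∀ (u v : Fin m → MvPolynomial (Fin 2) ℂ),
    (∀ j, coeff 0 (u j) = 0 ∧ (u j).support.card ≤ t) → (∀ j, coeff 0 (v j) = 0 ∧ (v j).support.card ≤ t) →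
    (∀ (J : Finset (Fin m)) (j₀ : Fin m), j₀ ∈ J →
      BlockSmall (fun j => (u j).support ∪ (v j).support) J (2 ^ m * (t + 2) ^ 4) →
      ¬ PermutationType.PermType (mergeA (fun j => (u j).support ∪ (v j).support) J j₀)) →
    (∀ (r : ℕ) (Jc : Fin r → Finset (Fin m)) (ac bc : Fin r → Fin m → Expo),
      ClassCover (fun j => (u j).support ∪ (v j).support) Jc ac bc →
      2 ^ m * (t + 2) ^ 4 < 2 * (m + 1) * (3 * (2 + m + m.choose 2) ^ 2) ^ r) →
    ¬ HasDatum (fun j => (u j).support ∪ (v j).support) →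
    (¬ ∃ L : Finset Expo, L.card ≤ C * m ∧
        PermutationType.R10Defs.LetterConfined (fun j => (u j).support ∪ (v j).support) L ∧
        PermutationType.R10Defs.FibreSpread (fun j => (u j).support ∪ (v j).support) L ((m + 2) ^ C)) →
    ∀ (R : Expo → Expo → Prop) (S : Finset Expo), IsCellFamily u v R S →
      S.card ≤ 2 ^ (a * m) * (t + 2) ^ b

/-- The v22 residual is WEAKER than the v21 one (it only adds a hypothesis; `C = 0`). -/
theorem residualLawV22_of_V21 (h : ResidualLawV21) : ResidualLawV22 := by
  obtain ⟨a, b, h⟩ := h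
  exact ⟨0, a, b, fun m t ht u v hu hv h10 hcc hD _ R S hS => h m t ht u v hu hv h10 hcc hD R S hS⟩

/-- **The v22 split recovers v21**: the v22 residual together with the R10 rung (for every `C`) gives the v21 residual — the composition
below is therefore `planarCellBound_v21` fed through this lemma (no new case analysis). -/
theorem residualLawV21_of_V22 (hR : ResidualLawV22) (h10 : ∀ C : ℕ, PermutationType.R10Defs.ConfinedTameLaw C) : ResidualLawV21 := by
  obtain ⟨C, a', b', hR⟩ := hR
  obtain ⟨a₁, b₁, h₁⟩ := h10 C
  refine ⟨a' + a₁, b' + b₁, fun m t ht u v hu hv hns hcc hD R S hS => ?_⟩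
  have ht2 : 1 ≤ t + 2 := by omega
  have hlift : ∀ {x a₀ b₀ : ℕ}, x ≤ 2 ^ (a₀ * m) * (t + 2) ^ b₀ → a₀ ≤ a' + a₁ → b₀ ≤ b' + b₁ →
      x ≤ 2 ^ ((a' + a₁) * m) * (t + 2) ^ (b' + b₁) := fun hx ha hb =>
    hx.trans (Nat.mul_le_mul (Nat.pow_le_pow_right (by norm_num) (Nat.mul_le_mul_right _ ha))
      (Nat.pow_le_pow_right ht2 hb))
  by_cases hct : ∃ L : Finset Expo, L.card ≤ C * m ∧
      PermutationType.R10Defs.LetterConfined (fun j => (u j).support ∪ (v j).support) L ∧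
      PermutationType.R10Defs.FibreSpread (fun j => (u j).support ∪ (v j).support) L ((m + 2) ^ C)
  · obtain ⟨L, hL, hLC, hFS⟩ := hct
    exact hlift (h₁ m t ht u v hu hv L hL hLC hFS R S hS) (by omega) (by omega)
  · exact hlift (hR m t ht u v hu hv hns hcc hD hct R S hS) (by omega) (by omega)

/-! ## v23: RUNG R11 (Stage 1) `RaySplitCellLaw` (val-idea-32 `freiman-ray-split`; PROVED by val-lit-p3 g16, δ-read val-port-3 g2) and the v23 residual -/

/-- **RUNG R11, Stage 1 (THEOREM, by name from Theorems)**: letters on `K` rays with no cross-ray coincidences ⇒ every cell family has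
`#S ≤ 2^((m+1)·K)` (t-free, any in-ray rank; `R11.raySplitCellLaw_holds`).  A PROPER positive sub-case of the residual. -/
theorem stub_raySplit : RaySplit.RaySplitCellLaw :=
  PermutationType.R11.raySplitCellLaw_holds

/-- **Residual v23** (LAW, 0 provers): the v22 residual MINUS, at the prover's chosen level `C`, every configuration whose tail alphabet lies on
`K ≤ C` rays with NO cross-ray coincidence (R11 Stage 1, PROVED).  What remains: rank ≥ 2, no R5 contraction, no cheap cover, not confined-tame
at level `C`, and not ray-split with `≤ C` rays.  HONEST LABEL: ⟺ `PlanarCellBound` for each fixed `C` (val-neg-1 g5's forecast; common deep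
monomial padding forces many rays). -/
def ResidualLawV23 : Prop :=
  ∃ C a b : ℕ, ∀ (m t : ℕ), 2 ≤ t → ∀ (u v : Fin m → MvPolynomial (Fin 2) ℂ),
    (∀ j, coeff 0 (u j) = 0 ∧ (u j).support.card ≤ t) → (∀ j, coeff 0 (v j) = 0 ∧ (v j).support.card ≤ t) →
    (∀ (J : Finset (Fin m)) (j₀ : Fin m), j₀ ∈ J →
      BlockSmall (fun j => (u j).support ∪ (v j).support) J (2 ^ m * (t + 2) ^ 4) →
      ¬ PermutationType.PermType (mergeA (fun j => (u j).support ∪ (v j).support) J j₀)) →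
    (∀ (r : ℕ) (Jc : Fin r → Finset (Fin m)) (ac bc : Fin r → Fin m → Expo),
      ClassCover (fun j => (u j).support ∪ (v j).support) Jc ac bc →
      2 ^ m * (t + 2) ^ 4 < 2 * (m + 1) * (3 * (2 + m + m.choose 2) ^ 2) ^ r) →
    ¬ HasDatum (fun j => (u j).support ∪ (v j).support) →
    (¬ ∃ L : Finset Expo, L.card ≤ C * m ∧
        PermutationType.R10Defs.LetterConfined (fun j => (u j).support ∪ (v j).support) L ∧
        PermutationType.R10Defs.FibreSpread (fun j => (u j).support ∪ (v j).support) L ((m + 2) ^ C)) →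
    (¬ ∃ K : ℕ, K ≤ C ∧ ∃ (g : Fin K → Expo) (ι : Expo → Fin K) (ν : Expo → ℕ), RaySplit.IndepRays g ∧
        RaySplit.OnRays g ι ν (tailSupport u v) ∧ RaySplit.RayCrossFree ι (fun j => (u j).support ∪ (v j).support)) →
    ∀ (R : Expo → Expo → Prop) (S : Finset Expo), IsCellFamily u v R S →
      S.card ≤ 2 ^ (a * m) * (t + 2) ^ b

/-- The v23 residual is WEAKER than the v22 one (one more hypothesis, same `C`). -/
theorem residualLawV23_of_V22 (h : ResidualLawV22) : ResidualLawV23 := by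
  obtain ⟨C, a, b, h⟩ := h
  exact ⟨C, a, b, fun m t ht u v hu hv h10 hcc hD hct _ R S hS => h m t ht u v hu hv h10 hcc hD hct R S hS⟩

/-- The ray-split bound at `K ≤ C` rays is of law shape: `2^((m+1)K) ≤ 2^(C m) (t+2)^C`. -/
theorem raySplit_arith (m t C K : ℕ) (hK : K ≤ C) : 2 ^ ((m + 1) * K) ≤ 2 ^ (C * m) * (t + 2) ^ C := by
  have h1 : (m + 1) * K ≤ C * m + C := by nlinarith
  calc 2 ^ ((m + 1) * K) ≤ 2 ^ (C * m + C) := Nat.pow_le_pow_right (by norm_num) h1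
    _ = 2 ^ (C * m) * 2 ^ C := by rw [pow_add]
    _ ≤ 2 ^ (C * m) * (t + 2) ^ C := Nat.mul_le_mul_left _ (Nat.pow_le_pow_left (by omega) C)

/-- **The v23 split recovers v22**: the v23 residual together with R11 Stage 1 gives the v22 residual. -/
theorem residualLawV22_of_V23 (hR : ResidualLawV23) (h11 : RaySplit.RaySplitCellLaw) : ResidualLawV22 := by
  obtain ⟨C, a', b', hR⟩ := hR
  refine ⟨C, a' + C, b' + C, fun m t ht u v hu hv hns hcc hD hct R S hS => ?_⟩
  have ht2 : 1 ≤ t + 2 := by omega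
  have hlift : ∀ {x a₀ b₀ : ℕ}, x ≤ 2 ^ (a₀ * m) * (t + 2) ^ b₀ → a₀ ≤ a' + C → b₀ ≤ b' + C →
      x ≤ 2 ^ ((a' + C) * m) * (t + 2) ^ (b' + C) := fun hx ha hb =>
    hx.trans (Nat.mul_le_mul (Nat.pow_le_pow_right (by norm_num) (Nat.mul_le_mul_right _ ha))
      (Nat.pow_le_pow_right ht2 hb))
  by_cases hrs : ∃ K : ℕ, K ≤ C ∧ ∃ (g : Fin K → Expo) (ι : Expo → Fin K) (ν : Expo → ℕ), RaySplit.IndepRays g ∧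
      RaySplit.OnRays g ι ν (tailSupport u v) ∧ RaySplit.RayCrossFree ι (fun j => (u j).support ∪ (v j).support)
  · obtain ⟨K, hK, g, ι, ν, hind, hon, hcf⟩ := hrs
    have hu0 : ∀ j, coeff 0 (u j) = 0 := fun j => (hu j).1
    have hv0 : ∀ j, coeff 0 (v j) = 0 := fun j => (hv j).1
    have h1 := h11 K m g ι ν u v hind hu0 hv0 hon hcf R S hS
    exact hlift (h1.trans (raySplit_arith m t C K hK)) (by omega) (by omega)
  · exact hlift (hR m t ht u v hu hv hns hcc hD hct hrs R S hS) (by omega) (by omega)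

/-! ## v24: RUNG R12 (B) `MomentRecord.ShiftedCarrierLaw` (PROVED) + K4 «WLOG submerged» (`Submerged.submergedReduction_holds`, PROVED) and the v24 residual -/

/-- **RUNG R12 (THEOREM, by name from Theorems)**: instances whose tail alphabet lies in `X ⊔ (X + d)` for carriers `x : Fin n → ℕ²` and ONE
shift `d ∈ ℤ²`, carrier-dissociated to depth `m`, obey the per-cell law with absolute `(a, b)` — `MomentRecord.shiftedCarrierLaw_holds` (✓ `Theorems/…MomentRecordShiftedCarrierLaw`).
Record letters are free ((A∘) `MomentRecordLawUsed`, idea-37 g4) + the lumped free-ring transfer (A∘) ⇒ (B) (val-lit-p3 g17).  A PROPER positive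
sub-case of the residual: its first members outside R3♯–R11 are `n ≥ 3` carriers (rank `n − 1` exchange lattice on one block of `2n ≍ t` letters). -/
theorem stub_shiftedCarrier : MomentRecord.ShiftedCarrierLaw :=
  MomentRecord.shiftedCarrierLaw_holds

/-- **K4 — THE SUBMERGED REDUCTION (THEOREM, by name from Theorems)**: the per-cell law for SUBMERGED cell families (every point strictly below
every tail letter at its witnessing weight) with exponents `(a, b)` implies the per-cell law for ALL cell families with exponents `(a+1, b+1)`
(`Submerged.submergedReduction_holds`, val-idea-36's band filtration + `BandStep` truncation from the floor, proved by val-lit-p3 g17).  An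
EQUIVALENCE of regimes (restriction is the converse), so it moves NO label; threaded below as the conclusion currency of the residual. -/
theorem stub_submerged : Submerged.SubmergedReduction :=
  Submerged.submergedReduction_holds

/-- Submerged cell families are cell families (drop the last clause). -/
theorem isCellFamily_of_submerged (u v : Fin m → MvPolynomial (Fin 2) ℂ) (R : Expo → Expo → Prop) (S : Finset Expo)
    (h : Submerged.IsSubmergedCellFamily u v R S) : IsCellFamily u v R S := fun l hl => by
  obtain ⟨ξ, hV, hT, hR, -⟩ := h l hl
  exact ⟨ξ, hV, hT, hR⟩

/-- **Residual v24** (LAW, 0 provers): the v23 residual MINUS every SHIFTED-CARRIER instance (R12, PROVED: tail alphabet inside `X ⊔ (X + d)` for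
some carriers `x : Fin n → ℕ²` and one shift `d ∈ ℤ²`, carrier-dissociated to depth `m`; `n` is free — (B)'s bound is uniform in `n`), and demanded
of SUBMERGED cell families only (K4, a PROVED-equivalent regime, cost `(a, b) ↦ (a+1, b+1)` in the cone).  What remains: coincidence rank ≥ 2, no
R5 contraction, no cheap R1_r cover, not confined-tame and not ray-split with `≤ C` independent rays at the chosen level `C`, not a shifted-carrier
class, and every visible point strictly below every letter.  HONEST LABEL: ⟺ `PlanarCellBound` for each fixed `C` (forecast; v23's label of
record is ✓ p662518; K4 is an equivalence). -/
def ResidualLawV24 : Prop :=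
  ∃ C a b : ℕ, ∀ (m t : ℕ), 2 ≤ t → ∀ (u v : Fin m → MvPolynomial (Fin 2) ℂ),
    (∀ j, coeff 0 (u j) = 0 ∧ (u j).support.card ≤ t) → (∀ j, coeff 0 (v j) = 0 ∧ (v j).support.card ≤ t) →
    (∀ (J : Finset (Fin m)) (j₀ : Fin m), j₀ ∈ J →
      BlockSmall (fun j => (u j).support ∪ (v j).support) J (2 ^ m * (t + 2) ^ 4) →
      ¬ PermutationType.PermType (mergeA (fun j => (u j).support ∪ (v j).support) J j₀)) →
    (∀ (r : ℕ) (Jc : Fin r → Finset (Fin m)) (ac bc : Fin r → Fin m → Expo),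
      ClassCover (fun j => (u j).support ∪ (v j).support) Jc ac bc →
      2 ^ m * (t + 2) ^ 4 < 2 * (m + 1) * (3 * (2 + m + m.choose 2) ^ 2) ^ r) →
    ¬ HasDatum (fun j => (u j).support ∪ (v j).support) →
    (¬ ∃ L : Finset Expo, L.card ≤ C * m ∧
        PermutationType.R10Defs.LetterConfined (fun j => (u j).support ∪ (v j).support) L ∧
        PermutationType.R10Defs.FibreSpread (fun j => (u j).support ∪ (v j).support) L ((m + 2) ^ C)) →
    (¬ ∃ K : ℕ, K ≤ C ∧ ∃ (g : Fin K → Expo) (ι : Expo → Fin K) (ν : Expo → ℕ), RaySplit.IndepRays g ∧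
        RaySplit.OnRays g ι ν (tailSupport u v) ∧ RaySplit.RayCrossFree ι (fun j => (u j).support ∪ (v j).support)) →
    (¬ ∃ (n : ℕ) (x : Fin n → Expo) (d : Fin 2 → ℤ),
        (∀ e ∈ tailSupport u v, ∃ i, e = x i ∨ ∀ c, ((e c : ℕ) : ℤ) = MomentRecord.shiftZ x d i c) ∧
        MomentRecord.CarrierDissociated x d m) →
    ∀ (R : Expo → Expo → Prop) (S : Finset Expo), Submerged.IsSubmergedCellFamily u v R S →
      S.card ≤ 2 ^ (a * m) * (t + 2) ^ b

/-- The v24 residual is WEAKER than the v23 one (one more hypothesis, same `C`; submerged families are cell families) — never stronger. -/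
theorem residualLawV24_of_V23 (h : ResidualLawV23) : ResidualLawV24 := by
  obtain ⟨C, a, b, h⟩ := h
  exact ⟨C, a, b, fun m t ht u v hu hv h10 hcc hD hct hrs _ R S hS =>
    h m t ht u v hu hv h10 hcc hD hct hrs R S (isCellFamily_of_submerged u v R S hS)⟩

/-! ## v25: RUNG R13♯ `TowerRecord.LevelFreeCarrierLawE` (PROVED — val-idea-37 g4 ⟶ val-lit-p3 g18; statements crit-8 g2) and the v25 residual -/

/-- **RUNG R13♯ (THEOREM, by name from Theorems)**: instances whose tail alphabet lies in `⊔_{j ∈ E} (X + j•d)` for carriers `x : Fin n → ℕ²`,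
ONE direction `d ∈ ℤ²` and ANY finite level set `E` (`TowerRecord.Lift.TowerAlphabet`), realizable-dissociated (`TowerRecord.TowerDissociatedE`:
shallow pairs `|S| ≤ m`, `k ∈ sumset E |S|` separated by `S•x + k•d`), obey the per-cell law with ABSOLUTE `(a, b)` — no height, no level count, no
box (`TowerRecord.levelFreeCarrierLawE_holds`, (11,1): val-idea-37 g4's valuated-matroid walk `levelFreeRecordLaw_holds` ∘ val-lit-p3 g18's realizable
Lift).  Contains R12 (`E = {0,1}`), R13 (`E = [0,D]`), the sparse-level and level-free forms BY NAME.  Carriers may be taken to be the classes of tail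
letters mod `ℤd`; overlapping towers on a common line are ONE tower (re-carriering), so row-lumped families are on the COVERED side.  HONEST LABEL:
a CLASS rung, inert as a hatch; not `PlanarCellBound`, not the crux. -/
theorem stub_levelFreeCarrierE : TowerRecord.LevelFreeCarrierLawE :=
  TowerRecord.levelFreeCarrierLawE_holds

/-- **Residual v25** (LAW, 0 provers): the v24 residual MINUS every ONE-DIRECTION PARALLEL-TOWER instance (R13♯, PROVED: tail alphabet inside
`⊔_{j ∈ E} (X + j•d)` for some carriers `x`, one shift `d`, any finite level set `E`, realizable-dissociated to depth `m`; `n` and `E` free — the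
law is uniform in both), for SUBMERGED cell families.  What remains (the residual of record after v25): coincidence rank ≥ 2, no R5 contraction, no
cheap R1_r cover, not confined-tame, not ray-split with `≤ C` rays, not a shifted-carrier class, NOT a one-direction tower class — i.e. the D-free
COLLISION residual (`(S,k) ↦ S•x + k•d` non-injective for every one-direction presentation: F10's collinear digit towers, fibre lumping) and
alphabets needing ≥ 2 independent shift directions — with every visible point strictly below every letter.  HONEST LABEL: ⟺ `PlanarCellBound` for
each fixed `C` (by construction: the cone below + the trivial converse). -/
def ResidualLawV25 : Prop :=
  ∃ C a b : ℕ, ∀ (m t : ℕ), 2 ≤ t → ∀ (u v : Fin m → MvPolynomial (Fin 2) ℂ),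
    (∀ j, coeff 0 (u j) = 0 ∧ (u j).support.card ≤ t) → (∀ j, coeff 0 (v j) = 0 ∧ (v j).support.card ≤ t) →
    (∀ (J : Finset (Fin m)) (j₀ : Fin m), j₀ ∈ J →
      BlockSmall (fun j => (u j).support ∪ (v j).support) J (2 ^ m * (t + 2) ^ 4) →
      ¬ PermutationType.PermType (mergeA (fun j => (u j).support ∪ (v j).support) J j₀)) →
    (∀ (r : ℕ) (Jc : Fin r → Finset (Fin m)) (ac bc : Fin r → Fin m → Expo),
      ClassCover (fun j => (u j).support ∪ (v j).support) Jc ac bc →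
      2 ^ m * (t + 2) ^ 4 < 2 * (m + 1) * (3 * (2 + m + m.choose 2) ^ 2) ^ r) →
    ¬ HasDatum (fun j => (u j).support ∪ (v j).support) →
    (¬ ∃ L : Finset Expo, L.card ≤ C * m ∧
        PermutationType.R10Defs.LetterConfined (fun j => (u j).support ∪ (v j).support) L ∧
        PermutationType.R10Defs.FibreSpread (fun j => (u j).support ∪ (v j).support) L ((m + 2) ^ C)) →
    (¬ ∃ K : ℕ, K ≤ C ∧ ∃ (g : Fin K → Expo) (ι : Expo → Fin K) (ν : Expo → ℕ), RaySplit.IndepRays g ∧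
        RaySplit.OnRays g ι ν (tailSupport u v) ∧ RaySplit.RayCrossFree ι (fun j => (u j).support ∪ (v j).support)) →
    (¬ ∃ (n : ℕ) (x : Fin n → Expo) (d : Fin 2 → ℤ),
        (∀ e ∈ tailSupport u v, ∃ i, e = x i ∨ ∀ c, ((e c : ℕ) : ℤ) = MomentRecord.shiftZ x d i c) ∧
        MomentRecord.CarrierDissociated x d m) →
    (¬ ∃ (n : ℕ) (x : Fin n → Expo) (d : Fin 2 → ℤ) (E : Finset ℕ),
        TowerRecord.Lift.TowerAlphabet u v x d E ∧ TowerRecord.TowerDissociatedE x d m E) →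
    ∀ (R : Expo → Expo → Prop) (S : Finset Expo), Submerged.IsSubmergedCellFamily u v R S →
      S.card ≤ 2 ^ (a * m) * (t + 2) ^ b

/-- The v25 residual is WEAKER than the v24 one (one more hypothesis, same `C`) — never stronger. -/
theorem residualLawV25_of_V24 (h : ResidualLawV24) : ResidualLawV25 := by
  obtain ⟨C, a, b, h⟩ := h
  exact ⟨C, a, b, fun m t ht u v hu hv h10 hcc hD hct hrs hsc _ R S hS =>
    h m t ht u v hu hv h10 hcc hD hct hrs hsc R S hS⟩

/-- THE ONE OPEN LAW INPUT OF THE CONE (LAW, 0 provers): the v25 residual (rank ≥ 2, no R5 contraction, no cheap cover, not confined-tame, not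
ray-split with `≤ C` independent rays, not a shifted-carrier class and not a one-direction parallel-tower class, for SUBMERGED cell families — the
D-free collision residual + ≥ 2 independent shift directions; ⟺ `PlanarCellBound` for each fixed `C`). -/
theorem stub_residual : ResidualLawV25 := by
  sorry

/-! ## Composition (kernel-checked, no sorry).  Superseded compositions v4–v19 were removed (git history: v4–v15 ≤ v17 @db78b88c90fb,
v16/v18 ≤ v18 @e7ad6555a1a7, v19 ≤ v19 @bc7a63357f94); the v21′/v23 cone body is git ≤ v23 @f0f1465b7f24, the v24 pair ≤ v24 @0e8636e50ed1. -/

/-- **v20 composition**: per cell, either a four-term rank-one witness (R6), or a three-letter rank-one witness (R7b; the unit / AP / free /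
homogeneous shapes embed into it), or a two-letter torsion witness (R7c), or a lattice-small block contraction to permutation type (R5/R3♯),
or a cheap relation-class cover (R1_r), or the v20 residual (fed the older three-letter negations through the witness embeddings). -/
theorem planarCellBound_v20 (hP : PermTypeLaw) (hC : RelationClassesLaw) (h6 : RankOneFourLaw) (h7b : RankOneThreeGenLaw)
    (h7c : RankOneTwoLaw) (hR : ResidualLawV20) :
    ∃ a b : ℕ, ∀ (m t : ℕ), 2 ≤ t → ∀ (u v : Fin m → MvPolynomial (Fin 2) ℂ),
      (∀ j, coeff 0 (u j) = 0 ∧ (u j).support.card ≤ t) → (∀ j, coeff 0 (v j) = 0 ∧ (v j).support.card ≤ t) →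
      ∀ (R : Expo → Expo → Prop) (S : Finset Expo),
        (∀ l ∈ S, ∃ ξ : Fin 2 → ℝ, ValidWeight u v ξ ∧ IsStrictTop ξ (logSupport u v) l ∧
          ∀ e ∈ ((Finset.univ.biUnion fun j => (u j).support) ∪ Finset.univ.biUnion fun j => (v j).support),
          ∀ e' ∈ ((Finset.univ.biUnion fun j => (u j).support) ∪ Finset.univ.biUnion fun j => (v j).support),
            (R e e' ↔ wt ξ e ≤ wt ξ e')) →
        S.card ≤ 2 ^ (a * m) * (t + 2) ^ b := by
  obtain ⟨a', b', hR⟩ := hR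
  obtain ⟨c, hc⟩ := cell_bound_of_rankOneFour h6
  obtain ⟨cG, hcG⟩ := cell_bound_of_rankOneThreeGen h7b
  obtain ⟨cW, hcW⟩ := cell_bound_of_rankOneTwo h7c
  refine ⟨a' + 15 + c + cG + cW, b' + 10 + c + cG + cW, ?_⟩
  intro m t ht u v hu hv R S hS
  have hS' : IsCellFamily u v R S := hS
  have ht2 : 1 ≤ t + 2 := by omega
  have hlift : ∀ {x a₁ b₁ : ℕ}, x ≤ 2 ^ (a₁ * m) * (t + 2) ^ b₁ → a₁ ≤ a' + 15 + c + cG + cW → b₁ ≤ b' + 10 + c + cG + cW →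
      x ≤ 2 ^ ((a' + 15 + c + cG + cW) * m) * (t + 2) ^ (b' + 10 + c + cG + cW) := fun hx ha hb =>
    hx.trans (Nat.mul_le_mul (Nat.pow_le_pow_right (by norm_num) (Nat.mul_le_mul_right _ ha))
      (Nat.pow_le_pow_right ht2 hb))
  by_cases h6w : FourTermRankOne (fun j => (u j).support ∪ (v j).support)
  · exact hlift (hc m t u v hu hv h6w R S hS') (by omega) (by omega)
  by_cases h7bw : ThreeTermGenRankOne (fun j => (u j).support ∪ (v j).support)
  · exact hlift (hcG m t u v hu hv h7bw R S hS') (by omega) (by omega)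
  by_cases h7cw : TwoTermRankOne (fun j => (u j).support ∪ (v j).support)
  · exact hlift (hcW m t u v hu hv h7cw R S hS') (by omega) (by omega)
  have h7aw : ¬ ThreeTermFreeRankOne (fun j => (u j).support ∪ (v j).support) := fun w =>
    h7bw (threeTermGenRankOne_of_free _ w)
  have h6dw : ¬ ThreeTermHomRankOne (fun j => (u j).support ∪ (v j).support) := fun w =>
    h7bw (threeTermGenRankOne_of_hom _ w)
  have h6bw : ¬ ThreeTermRankOne (fun j => (u j).support ∪ (v j).support) := fun w =>
    h7aw (threeTermFreeRankOne_of_threeTerm _ w)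
  have h6cw : ¬ ThreeTermAPRankOne (fun j => (u j).support ∪ (v j).support) := fun w =>
    h6dw (threeTermHomRankOne_of_AP _ w)
  by_cases h10 : ∀ (J : Finset (Fin m)) (j₀ : Fin m), j₀ ∈ J →
      BlockSmall (fun j => (u j).support ∪ (v j).support) J (2 ^ m * (t + 2) ^ 4) →
      ¬ PermutationType.PermType (mergeA (fun j => (u j).support ∪ (v j).support) J j₀)
  · by_cases hcc : ∀ (r : ℕ) (Jc : Fin r → Finset (Fin m)) (ac bc : Fin r → Fin m → Expo),
        ClassCover (fun j => (u j).support ∪ (v j).support) Jc ac bc →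
        2 ^ m * (t + 2) ^ 4 < 2 * (m + 1) * (3 * (2 + m + m.choose 2) ^ 2) ^ r
    · exact hlift (hR m t ht u v hu hv h10 hcc h6w h6bw h6cw h7aw h6dw h7bw h7cw R S hS') (by omega) (by omega)
    · push Not at hcc
      obtain ⟨r, Jc, ac, bc, hcov, hcheap⟩ := hcc
      have h1 : S.card ≤ 2 ^ (1 * m) * (t + 2) ^ 4 := by
        simpa using cell_bound_of_cheapCover hC t u v hu hv Jc ac bc hcov hcheap R S hS'
      exact hlift h1 (by omega) (by omega)
  · push Not at h10
    obtain ⟨J, j₀, hj₀, hsmall, hperm⟩ := h10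
    exact hlift (cell_bound_of_mergedPermType hP t u v hu hv J j₀ hj₀ hsmall hperm R S hS') (by omega) (by omega)

/-- **v21 composition**: per cell, either a rank-one DATUM (R9 — covers permutation type, R6, R6b, R6c, R7a, R7b, R7c, R8 and every other
rank ≤ 1 configuration), or a lattice-small block contraction to permutation type (R5/R3♯), or a cheap relation-class cover (R1_r), or the v21
residual. -/
theorem planarCellBound_v21 (hP : PermTypeLaw) (hC : RelationClassesLaw) (h9 : RankOneSchemaLaw) (hR : ResidualLawV21) :
    ∃ a b : ℕ, ∀ (m t : ℕ), 2 ≤ t → ∀ (u v : Fin m → MvPolynomial (Fin 2) ℂ),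
      (∀ j, coeff 0 (u j) = 0 ∧ (u j).support.card ≤ t) → (∀ j, coeff 0 (v j) = 0 ∧ (v j).support.card ≤ t) →
      ∀ (R : Expo → Expo → Prop) (S : Finset Expo),
        (∀ l ∈ S, ∃ ξ : Fin 2 → ℝ, ValidWeight u v ξ ∧ IsStrictTop ξ (logSupport u v) l ∧
          ∀ e ∈ ((Finset.univ.biUnion fun j => (u j).support) ∪ Finset.univ.biUnion fun j => (v j).support),
          ∀ e' ∈ ((Finset.univ.biUnion fun j => (u j).support) ∪ Finset.univ.biUnion fun j => (v j).support),
            (R e e' ↔ wt ξ e ≤ wt ξ e')) →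
        S.card ≤ 2 ^ (a * m) * (t + 2) ^ b := by
  obtain ⟨a', b', hR⟩ := hR
  obtain ⟨c, hc⟩ := cell_bound_of_rankOneSchema h9
  refine ⟨a' + 15 + c, b' + 10 + c, ?_⟩
  intro m t ht u v hu hv R S hS
  have hS' : IsCellFamily u v R S := hS
  have ht2 : 1 ≤ t + 2 := by omega
  have hlift : ∀ {x a₁ b₁ : ℕ}, x ≤ 2 ^ (a₁ * m) * (t + 2) ^ b₁ → a₁ ≤ a' + 15 + c → b₁ ≤ b' + 10 + c →
      x ≤ 2 ^ ((a' + 15 + c) * m) * (t + 2) ^ (b' + 10 + c) := fun hx ha hb =>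
    hx.trans (Nat.mul_le_mul (Nat.pow_le_pow_right (by norm_num) (Nat.mul_le_mul_right _ ha))
      (Nat.pow_le_pow_right ht2 hb))
  by_cases hD : HasDatum (fun j => (u j).support ∪ (v j).support)
  · exact hlift (hc m t u v hu hv hD R S hS') (by omega) (by omega)
  by_cases h10 : ∀ (J : Finset (Fin m)) (j₀ : Fin m), j₀ ∈ J →
      BlockSmall (fun j => (u j).support ∪ (v j).support) J (2 ^ m * (t + 2) ^ 4) →
      ¬ PermutationType.PermType (mergeA (fun j => (u j).support ∪ (v j).support) J j₀)
  · by_cases hcc : ∀ (r : ℕ) (Jc : Fin r → Finset (Fin m)) (ac bc : Fin r → Fin m → Expo),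
        ClassCover (fun j => (u j).support ∪ (v j).support) Jc ac bc →
        2 ^ m * (t + 2) ^ 4 < 2 * (m + 1) * (3 * (2 + m + m.choose 2) ^ 2) ^ r
    · exact hlift (hR m t ht u v hu hv h10 hcc hD R S hS') (by omega) (by omega)
    · push Not at hcc
      obtain ⟨r, Jc, ac, bc, hcov, hcheap⟩ := hcc
      have h1 : S.card ≤ 2 ^ (1 * m) * (t + 2) ^ 4 := by
        simpa using cell_bound_of_cheapCover hC t u v hu hv Jc ac bc hcov hcheap R S hS'
      exact hlift h1 (by omega) (by omega)
  · push Not at h10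
    obtain ⟨J, j₀, hj₀, hsmall, hperm⟩ := h10
    exact hlift (cell_bound_of_mergedPermType hP t u v hu hv J j₀ hj₀ hsmall hperm R S hS') (by omega) (by omega)

/-- **v25 composition, submerged currency**: for every SUBMERGED cell family of a normalised `t`-sparse instance, either a rank-one DATUM (R9), or
a lattice-small block contraction to permutation type (R5/R3♯), or a cheap relation-class cover (R1_r), or — at the residual's level `C` — a
confined-tame letter set (R10), a ray splitting with `≤ C` independent rays (R11), a shifted-carrier structure (R12), a one-direction tower alphabet
with realizable dissociation (R13♯, constants max'd with the residual's exactly as v24 did for R12), or the v25 residual.  The rungs are applied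
through `isCellFamily_of_submerged`; K4 is the next lemma.  (v24's `submergedCellLaw_v24` / `planarCellBound_v24`: git ≤ v24 @0e8636e50ed1.) -/
theorem submergedCellLaw_v25 (hP : PermTypeLaw) (hC : RelationClassesLaw) (h9 : RankOneSchemaLaw)
    (h10 : ∀ C : ℕ, PermutationType.R10Defs.ConfinedTameLaw C) (h11 : RaySplit.RaySplitCellLaw)
    (h12 : MomentRecord.ShiftedCarrierLaw) (h13 : TowerRecord.LevelFreeCarrierLawE) (hR : ResidualLawV25) :
    ∃ a b : ℕ, Submerged.SubmergedCellLaw a b := by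
  obtain ⟨C, a', b', hR⟩ := hR
  obtain ⟨c, hc⟩ := cell_bound_of_rankOneSchema h9
  obtain ⟨a₁, b₁, h₁⟩ := h10 C
  obtain ⟨a₂, b₂, h₂⟩ := h12
  obtain ⟨a₃, b₃, h₃⟩ := h13
  refine ⟨a' + 15 + c + a₁ + C + a₂ + a₃, b' + 10 + c + b₁ + C + b₂ + b₃, ?_⟩
  intro m t ht u v hu hv R S hS
  have hS' : IsCellFamily u v R S := isCellFamily_of_submerged u v R S hS
  have ht2 : 1 ≤ t + 2 := by omega
  have hlift : ∀ {x a₀ b₀ : ℕ}, x ≤ 2 ^ (a₀ * m) * (t + 2) ^ b₀ → a₀ ≤ a' + 15 + c + a₁ + C + a₂ + a₃ →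
      b₀ ≤ b' + 10 + c + b₁ + C + b₂ + b₃ →
      x ≤ 2 ^ ((a' + 15 + c + a₁ + C + a₂ + a₃) * m) * (t + 2) ^ (b' + 10 + c + b₁ + C + b₂ + b₃) := fun hx ha hb =>
    hx.trans (Nat.mul_le_mul (Nat.pow_le_pow_right (by norm_num) (Nat.mul_le_mul_right _ ha))
      (Nat.pow_le_pow_right ht2 hb))
  by_cases hD : HasDatum (fun j => (u j).support ∪ (v j).support)
  · exact hlift (hc m t u v hu hv hD R S hS') (by omega) (by omega)
  by_cases h10' : ∀ (J : Finset (Fin m)) (j₀ : Fin m), j₀ ∈ J →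
      BlockSmall (fun j => (u j).support ∪ (v j).support) J (2 ^ m * (t + 2) ^ 4) →
      ¬ PermutationType.PermType (mergeA (fun j => (u j).support ∪ (v j).support) J j₀)
  · by_cases hcc : ∀ (r : ℕ) (Jc : Fin r → Finset (Fin m)) (ac bc : Fin r → Fin m → Expo),
        ClassCover (fun j => (u j).support ∪ (v j).support) Jc ac bc →
        2 ^ m * (t + 2) ^ 4 < 2 * (m + 1) * (3 * (2 + m + m.choose 2) ^ 2) ^ r
    · by_cases hct : ∃ L : Finset Expo, L.card ≤ C * m ∧
          PermutationType.R10Defs.LetterConfined (fun j => (u j).support ∪ (v j).support) L ∧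
          PermutationType.R10Defs.FibreSpread (fun j => (u j).support ∪ (v j).support) L ((m + 2) ^ C)
      · obtain ⟨L, hL, hLC, hFS⟩ := hct
        exact hlift (h₁ m t ht u v hu hv L hL hLC hFS R S hS') (by omega) (by omega)
      by_cases hrs : ∃ K : ℕ, K ≤ C ∧ ∃ (g : Fin K → Expo) (ι : Expo → Fin K) (ν : Expo → ℕ), RaySplit.IndepRays g ∧
          RaySplit.OnRays g ι ν (tailSupport u v) ∧ RaySplit.RayCrossFree ι (fun j => (u j).support ∪ (v j).support)
      · obtain ⟨K, hK, g, ι, ν, hind, hon, hcf⟩ := hrs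
        have hu0 : ∀ j, coeff 0 (u j) = 0 := fun j => (hu j).1
        have hv0 : ∀ j, coeff 0 (v j) = 0 := fun j => (hv j).1
        have h1 := h11 K m g ι ν u v hind hu0 hv0 hon hcf R S hS'
        exact hlift (h1.trans (raySplit_arith m t C K hK)) (by omega) (by omega)
      by_cases hsc : ∃ (n : ℕ) (x : Fin n → Expo) (d : Fin 2 → ℤ),
          (∀ e ∈ tailSupport u v, ∃ i, e = x i ∨ ∀ c, ((e c : ℕ) : ℤ) = MomentRecord.shiftZ x d i c) ∧
          MomentRecord.CarrierDissociated x d m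
      · obtain ⟨n, x, d, halph, hdis⟩ := hsc
        exact hlift (h₂ m t n u v x d ht hu hv halph hdis R S hS') (by omega) (by omega)
      by_cases htw : ∃ (n : ℕ) (x : Fin n → Expo) (d : Fin 2 → ℤ) (E : Finset ℕ),
          TowerRecord.Lift.TowerAlphabet u v x d E ∧ TowerRecord.TowerDissociatedE x d m E
      · obtain ⟨n, x, d, E, halph, hdis⟩ := htw
        exact hlift (h₃ m t n u v x d E ht hu hv halph hdis R S hS') (by omega) (by omega)
      exact hlift (hR m t ht u v hu hv h10' hcc hD hct hrs hsc htw R S hS) (by omega) (by omega)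
    · push Not at hcc
      obtain ⟨r, Jc, ac, bc, hcov, hcheap⟩ := hcc
      have h1 : S.card ≤ 2 ^ (1 * m) * (t + 2) ^ 4 := by
        simpa using cell_bound_of_cheapCover hC t u v hu hv Jc ac bc hcov hcheap R S hS'
      exact hlift h1 (by omega) (by omega)
  · push Not at h10'
    obtain ⟨J, j₀, hj₀, hsmall, hperm⟩ := h10'
    exact hlift (cell_bound_of_mergedPermType hP t u v hu hv J j₀ hj₀ hsmall hperm R S hS') (by omega) (by omega)

/-- **v25 composition, `PlanarCellBound` shape**: K4 (`Submerged.SubmergedReduction`, by name) lifts the submerged per-cell law of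
`submergedCellLaw_v25` to all cell families at cost `(a, b) ↦ (a+1, b+1)`. -/
theorem planarCellBound_v25 (hP : PermTypeLaw) (hC : RelationClassesLaw) (h9 : RankOneSchemaLaw)
    (h10 : ∀ C : ℕ, PermutationType.R10Defs.ConfinedTameLaw C) (h11 : RaySplit.RaySplitCellLaw)
    (h12 : MomentRecord.ShiftedCarrierLaw) (h13 : TowerRecord.LevelFreeCarrierLawE) (hK4 : Submerged.SubmergedReduction)
    (hR : ResidualLawV25) :
    ∃ a b : ℕ, ∀ (m t : ℕ), 2 ≤ t → ∀ (u v : Fin m → MvPolynomial (Fin 2) ℂ),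
      (∀ j, coeff 0 (u j) = 0 ∧ (u j).support.card ≤ t) → (∀ j, coeff 0 (v j) = 0 ∧ (v j).support.card ≤ t) →
      ∀ (R : Expo → Expo → Prop) (S : Finset Expo),
        (∀ l ∈ S, ∃ ξ : Fin 2 → ℝ, ValidWeight u v ξ ∧ IsStrictTop ξ (logSupport u v) l ∧
          ∀ e ∈ ((Finset.univ.biUnion fun j => (u j).support) ∪ Finset.univ.biUnion fun j => (v j).support),
          ∀ e' ∈ ((Finset.univ.biUnion fun j => (u j).support) ∪ Finset.univ.biUnion fun j => (v j).support),
            (R e e' ↔ wt ξ e ≤ wt ξ e')) →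
        S.card ≤ 2 ^ (a * m) * (t + 2) ^ b := by
  obtain ⟨a, b, h⟩ := submergedCellLaw_v25 hP hC h9 h10 h11 h12 h13 hR
  exact ⟨a + 1, b + 1, hK4 a b h⟩

/-- **v25 cone — the ONLY declaration of this file concluding the crux BY NAME** (so the registry's skeleton check has exactly one
candidate; `planarCellBound_v20/v21/v25` keep the parametrised compositions): the crux from the registered stubs R3♯ `stub_permType`, R1_r
`stub_relationClasses`, R9 `stub_rankOneSchema`, R10 `stub_confinedTame` (∀ C), R11 `stub_raySplit`, R12 `stub_shiftedCarrier`, R13♯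
`stub_levelFreeCarrierE`, K4 `stub_submerged` (all kernel theorems, by name from Theorems) and the ONE sorry `stub_residual : ResidualLawV25` (LAW),
through `planarCellBound_v25`. -/
theorem TwoProducts_holds_of_stubs :
    Summit.ValiantsHypothesis.ValiantsHypothesis.Theses.NewtonUnitEquations.TwoProducts :=
  twoProducts_of_planarCellBound (planarCellBound_v25 stub_permType stub_relationClasses stub_rankOneSchema
    stub_confinedTame stub_raySplit stub_shiftedCarrier stub_levelFreeCarrierE stub_submerged stub_residual)

end Summit.ValiantsHypothesis.ValiantsHypothesis.Cruxes.TwoProducts.RelationLadder
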